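import Mathlib.Algebra.BigOperators.Ring.Finset
import Mathlib.Algebra.MvPolynomial.Eval
import Mathlib.Combinatorics.SimpleGraph.Acyclic
import Mathlib.Combinatorics.SimpleGraph.Maps
import Mathlib.Combinatorics.SimpleGraph.Operations
import Mathlib.Combinatorics.SimpleGraph.Sum
import Mathlib.Data.Fin.Tuple.Basic
import Mathlib.Data.Fin.VecNotation
import Mathlib.Data.Finite.Prod
import Mathlib.Data.Finite.Sum
import Mathlib.Data.Finsupp.Basic
import Mathlib.Data.Fintype.BigOperators
import Mathlib.Logic.Equiv.Fin.Basic
import Mathlib.SetTheory.Cardinal.Finite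
import Mathlib.SetTheory.Cardinal.NatCard
import Mathlib.Tactic.FinCases
import Mathlib.Tactic.Linarith
import Mathlib.Tactic.Push
import Mathlib.Tactic.Ring
import Literature.ModelTheory.FiniteModelTheory.CkEquiv

/-!
# `C^k`-equivalence is homomorphism indistinguishability over treewidth `< k` (Dvořák 2010)

This file DISCHARGES the named fact
`Literature.ModelTheory.FiniteModelTheory.Dvorak2010_ckEquiv_iff_homCount` of `CkEquiv.lean`:

* `Dvorak2010_ckEquiv_iff_homCount_holds` — for `k ≥ 2` and finite simple graphs `G` on `Fin n`,
  `H` on `Fin m`: `CkEquiv k G H` (Duplicator wins Hella's bijective `k`-pebble game) iff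
  `Nat.card (F →g G) = Nat.card (F →g H)` for every `F` on `Fin j` with
  `Literature.Combinatorics.SimpleGraph.treewidth F < k`.

Sources. Dvořák 2010, Thm 6 (author's version, read pp. 1–8): "(1) there is a closed formula
`φ ∈ C^{k+1}` with `H₁ ⊨ φ`, `H₂ ⊭ φ` iff (2) there is a graph `G` of tree-width at most `k`
with `Hom(G, H₁) ≠ Hom(G, H₂)`", proved through `k+1`-labelled graphs of tree-width `≤ k`
(§2: the inductive class generated from all-labelled graphs by products `G₁G₂` and label
removal), Lemma 3 (hom counts of such graphs are `C^{k+1}`-definable), Observation 4 (an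
interpolating polynomial turns a labelled quantum graph into a `0/1`-valued one) and Lemma 5
(every `C^{k+1}` formula is modelled by a quantum graph). Equivalent statement:
Dell–Grohe–Rattan 2018, Thm 3 with Lemma 12; the game characterisation of `C^k` is Hella 1996
(Grohe–Otto 2015, Thm 2.2). Dvořák's `k + 1` is our `k`.

## The proof formalised here (and where it deviates)

`CkEquiv` is DEFINED by the bijective pebble game (`BijPebbleStrategy`), and the tree has no
syntax/semantics of the counting logic `C^k`; so instead of Dvořák's logic ↔ hom-counts we prove
GAME ↔ HOM-COUNTS directly. Both directions follow Dvořák's architecture with the game in place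
of formulas:

* **Game ⇒ hom counts** (`Dvorak2010.forward_main`, `Dvorak2010.card_hom_eq_of_ckEquiv`; holds
  for `k ≥ 1`). The game form of Lemma 3: for a graph `F` with a tree decomposition of bags of
  size `≤ k` and a set `X` of constrained vertices inside one bag, the numbers of homomorphisms
  `F → G`, `F → H` with prescribed values on `X` taken from a position of the strategy agree
  (`Dvorak2010.ccount`). Induction on `|N|·(|V|+1) + |V ∖ X|` over PARTIAL decompositions
  (`Dvorak2010.PreDecomp`: a linked node set `N` of a fixed ambient tree with fixed bags):
  extend `X` inside the bag by one vertex = one forth move of Duplicator (fibre sum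
  `ccount_eq_sum_insert`); a single bag = partial isomorphism; the apex a leaf = localise the
  edges inside `X` (`ccount_killIn`), drop the apex and free its private vertices
  (`ccount_union_mul`); otherwise split `N` at the apex into the component of a neighbour and
  the rest (`Linked.gateway`, `Linked.avoid`, multiplicativity `ccount_sup_mul`). The junk
  factors `|V(G)|^c` cancel because `|V(G)| = |V(H)|` (`CkEquiv.card_eq`).
* **Hom counts ⇒ game** (`Dvorak2010.homStrategy`, `k ≥ 2`). The positions of Duplicator's
  strategy (`Dvorak2010.homFamily`) are the partial injections `p` with `≤ k` pairs such that
  every VALID `ℓ`-labelled test graph — a graph on `Fin ℓ ⊕ Fin r` (labels = left summand, all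
  distinct: Dvořák's `k`-labelled graphs) with a tree decomposition of bags `≤ k` one of which
  is exactly the label set (`Dvorak2010.LValid`, = his labelled graphs of tree-width `≤ k-1`) —
  has equal labelled hom counts (`Dvorak2010.lcount`, his `Hom(G, H)` for labelled graphs) into
  `(G, left of p)` and `(H, right of p)`. Level `0` is the hypothesis; the edge test
  (`Dvorak2010.edgeTest`, Lemma 5's `K₂`) makes positions partial isomorphisms (this is where
  `k ≥ 2` enters); the forth property (`Dvorak2010.homFamily_forth`) is Lemma 5 + Observation 4
  for the game: the types `a ↦ (t ↦ lcount t G (ā, a))` over valid `(ℓ+1)`-tests have equal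
  mixed moments on the two sides — products of tests are tests (`Dvorak2010.glue`,
  `lcount_glue`, `lvalid_glue`: his `G₁G₂`), removing the last label sums over it
  (`Dvorak2010.unlabel`, `lcount_unlabel`, `lvalid_unlabel`: his label removal) — hence, by
  interpolation (`Dvorak2010.card_fiber_eq_of_moments`, his Observation 4, with
  `MvPolynomial`), every type is realised equally often off `p`, which gives a type-preserving
  bijection extending `p` (`Dvorak2010.exists_equiv_extend`); new positions pass every test by
  pushing its labels into `Fin (ℓ+1)` (`Dvorak2010.push`, `lcount_push`, `lvalid_push`: labels
  on "not necessarily distinct vertices").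

Supporting material of independent interest, all proved: bare-function homomorphisms
(`Dvorak2010.IsHom`), connectivity of node sets through themselves as a reflexive–transitive
closure (`Dvorak2010.Linked`, `connected_induce_iff`), sums of acyclic graphs are acyclic
(`Dvorak2010.isAcyclic_sum`), joining two (half) tree decompositions along a new tree edge
(`Dvorak2010.Join.treeDecomposition`), transport/reindexing of tree decompositions
(`TreeDecomposition.transport`, `TreeDecomposition.reindex`) and
`treewidth_map_le_of_card_bag_le`.

Design. Counting is done on bare functions `V → γ` (`ccount`, `lcount`; `card_hom_eq_card_subtype`
bridges to `F →g G`), which makes fibre sums and the "independent coordinates multiply" lemma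
(`card_and_mul_card_fun`) elementary. The vertex type of the source graph is kept FIXED in the
forward induction (edges are deleted instead of vertices), at the price of explicit powers of
`|V(G)|`. Test graphs carry their labels as the summand `Fin ℓ`, so that Dvořák's product needs
no quotient. NOT here: the logic `C^k` itself, Weisfeiler–Leman, the cases `k ≤ 1` (settled in
`CkEquiv.lean`), infinite graphs.

## References

* [Dvorak2010] Z. Dvořák, *On recognizing graphs by numbers of homomorphisms*, J. Graph Theory
  64 (2010) 330–342, doi:10.1002/jgt.20461 — §2 (labelled graphs of bounded tree-width,
  products, label removal), Lemma 3, Observation 4, Lemma 5, Thm 6. Read via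
  `lit read doi-10-1002-jgt-20461`, pp. 1–8.
* [DellGroheRattan2018] H. Dell, M. Grohe, G. Rattan, *Lovász meets Weisfeiler and Leman*,
  ICALP 2018, Thm 3 / Lemma 12 (the same equivalence through `k`-WL).
* [GroheOtto2015] M. Grohe, M. Otto, *Pebble games and linear equations*, J. Symb. Log. 80
  (2015), Thm 2.2 (Hella's theorem; the game taken as the definition of `CkEquiv`).
* [MarkovShi2008] I. L. Markov, Y. Shi, SIAM J. Comput. 38 (2008), §2 (tree decompositions, as
  formalised in `Literature.Combinatorics.SimpleGraph.TreeDecomposition`).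
-/

namespace Literature.ModelTheory.FiniteModelTheory

open _root_.SimpleGraph Literature.Combinatorics.SimpleGraph

namespace Dvorak2010

/-! ### A. Homomorphisms as bare functions -/

section IsHom

variable {V W γ : Type*}

/-- `g : V → γ` is a graph homomorphism `F → G`, as a bare function. [folklore] -/
def IsHom (F : SimpleGraph V) (G : SimpleGraph γ) (g : V → γ) : Prop :=
  ∀ ⦃a b : V⦄, F.Adj a b → G.Adj (g a) (g b)

/-- A function is a homomorphism out of `F₁ ⊔ F₂` iff it is one out of both. [folklore] -/
theorem isHom_sup_iff {F₁ F₂ : SimpleGraph V} {G : SimpleGraph γ} {g : V → γ} :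
    IsHom (F₁ ⊔ F₂) G g ↔ IsHom F₁ G g ∧ IsHom F₂ G g :=
  ⟨fun h => ⟨fun _ _ hab => h (Or.inl hab), fun _ _ hab => h (Or.inr hab)⟩,
    fun h _ _ hab => hab.elim (fun h₁ => h.1 h₁) (fun h₂ => h.2 h₂)⟩

/-- Homomorphisms out of a pushforward `F.map φ` along a map `φ` that never identifies the
two ends of an edge are exactly the functions whose composite with `φ` is a homomorphism out
of `F`. [folklore] -/
theorem isHom_map_iff {F : SimpleGraph V} {G : SimpleGraph γ} (φ : V → W)
    (hφ : ∀ ⦃a b : V⦄, F.Adj a b → φ a ≠ φ b) {g : W → γ} :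
    IsHom (F.map φ) G g ↔ IsHom F G (g ∘ φ) := by
  constructor
  · intro h a b hab
    exact h ⟨hφ hab, a, b, hab, rfl, rfl⟩
  · rintro h u v ⟨-, a, b, hab, rfl, rfl⟩
    exact h hab

/-- A homomorphism out of `F` is one out of any spanning subgraph of `F`. [folklore] -/
theorem IsHom.anti {F F' : SimpleGraph V} {G : SimpleGraph γ} {g : V → γ} (h : IsHom F G g)
    (hle : F' ≤ F) : IsHom F' G g :=
  fun _ _ hab => h (hle hab)

/-- Every function is a homomorphism out of the edgeless graph. [folklore] -/
theorem isHom_bot (G : SimpleGraph γ) (g : V → γ) : IsHom (⊥ : SimpleGraph V) G g :=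
  fun _ _ hab => hab.elim

/-- Bundled homomorphisms `F →g G` are the functions satisfying `IsHom`. [folklore] -/
def homEquivSubtype (F : SimpleGraph V) (G : SimpleGraph γ) :
    (F →g G) ≃ {g : V → γ // IsHom F G g} where
  toFun h := ⟨h, fun _ _ hab => h.map_rel hab⟩
  invFun g := ⟨g.1, fun hab => g.2 hab⟩
  left_inv _ := RelHom.ext fun _ => rfl
  right_inv _ := rfl

/-- `|F →g G|` counted through bare functions. [folklore] -/
theorem card_hom_eq_card_subtype (F : SimpleGraph V) (G : SimpleGraph γ) :
    Nat.card (F →g G) = Nat.card {g : V → γ // IsHom F G g} :=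
  Nat.card_congr (homEquivSubtype F G)

end IsHom

/-! ### B. Connectivity of a set of tree nodes through itself -/

section Linked

variable {ι ι' : Type*}

/-- `Linked T S a b`: `a` and `b` are joined by a walk of `T` all of whose vertices lie in
`S` (reflexive–transitive closure of adjacency inside `S`). [folklore] -/
def Linked (T : SimpleGraph ι) (S : Set ι) (a b : ι) : Prop :=
  Relation.ReflTransGen (fun x y => T.Adj x y ∧ x ∈ S ∧ y ∈ S) a b

namespace Linked

variable {T : SimpleGraph ι} {S S' : Set ι} {a b c : ι}

/-- [folklore] -/
theorem refl (a : ι) : Linked T S a a := Relation.ReflTransGen.refl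

/-- [folklore] -/
theorem trans (h₁ : Linked T S a b) (h₂ : Linked T S b c) : Linked T S a c :=
  Relation.ReflTransGen.trans h₁ h₂

/-- [folklore] -/
theorem symm (h : Linked T S a b) : Linked T S b a := by
  induction h with
  | refl => exact Relation.ReflTransGen.refl
  | tail _ hbc ih => exact Relation.ReflTransGen.head ⟨hbc.1.symm, hbc.2.2, hbc.2.1⟩ ih

/-- [folklore] -/
theorem single (hab : T.Adj a b) (ha : a ∈ S) (hb : b ∈ S) : Linked T S a b :=
  Relation.ReflTransGen.single ⟨hab, ha, hb⟩

/-- [folklore] -/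
theorem tail (h : Linked T S a b) (hbc : T.Adj b c) (hb : b ∈ S) (hc : c ∈ S) : Linked T S a c :=
  Relation.ReflTransGen.tail h ⟨hbc, hb, hc⟩

/-- [folklore] -/
theorem mono (h : Linked T S a b) (hSS' : S ⊆ S') : Linked T S' a b := by
  induction h with
  | refl => exact Relation.ReflTransGen.refl
  | tail _ hbc ih => exact Relation.ReflTransGen.tail ih ⟨hbc.1, hSS' hbc.2.1, hSS' hbc.2.2⟩

/-- The far end of a nontrivial link lies in the set. [folklore] -/
theorem mem_or_eq (h : Linked T S a b) : b ∈ S ∨ b = a := by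
  induction h with
  | refl => exact Or.inr rfl
  | tail _ hbc _ => exact Or.inl hbc.2.2

/-- [folklore] -/
theorem mem_right (h : Linked T S a b) (ha : a ∈ S) : b ∈ S :=
  h.mem_or_eq.elim id fun hb => hb ▸ ha

/-- [folklore] -/
theorem mem_left (h : Linked T S a b) (hb : b ∈ S) : a ∈ S :=
  h.symm.mem_right hb

/-- Links are transported along maps preserving adjacency on `S` and mapping `S` into `S'`.
[folklore] -/
theorem map {T' : SimpleGraph ι'} {S' : Set ι'} (f : ι → ι')
    (hadj : ∀ ⦃x y⦄, x ∈ S → y ∈ S → T.Adj x y → T'.Adj (f x) (f y))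
    (hS : ∀ ⦃x⦄, x ∈ S → f x ∈ S') (h : Linked T S a b) : Linked T' S' (f a) (f b) := by
  induction h with
  | refl => exact Relation.ReflTransGen.refl
  | tail _ hbc ih =>
    exact Relation.ReflTransGen.tail ih ⟨hadj hbc.2.1 hbc.2.2 hbc.1, hS hbc.2.1, hS hbc.2.2⟩

/-- A link yields a walk of `T` supported in `S ∪ {a}`. [folklore] -/
theorem exists_walk (h : Linked T S a b) :
    ∃ w : T.Walk a b, ∀ x ∈ w.support, x ∈ S ∨ x = a := by
  induction h with
  | refl => exact ⟨Walk.nil, fun x hx => Or.inr (by simpa using hx)⟩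
  | tail _ hbc ih =>
    obtain ⟨w, hw⟩ := ih
    refine ⟨w.append (Walk.cons hbc.1 Walk.nil), fun x hx => ?_⟩
    rw [Walk.support_append] at hx
    rcases List.mem_append.1 hx with hx | hx
    · exact hw x hx
    · simp only [Walk.support_cons, Walk.support_nil, List.tail_cons, List.mem_singleton] at hx
      exact Or.inl (hx ▸ hbc.2.2)

/-- Reachability in `T` gives a link through the whole vertex set. [folklore] -/
theorem of_reachable (h : T.Reachable a b) : Linked T Set.univ a b := by
  have h' := (reachable_iff_reflTransGen a b).1 h
  clear h
  induction h' with
  | refl => exact Relation.ReflTransGen.refl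
  | tail _ hbc ih => exact Relation.ReflTransGen.tail ih ⟨hbc, trivial, trivial⟩

end Linked

/-- The subgraph of `T` induced on `S` is connected iff `S` is nonempty and pairwise linked
through `S`. [folklore] -/
theorem connected_induce_iff {T : SimpleGraph ι} {S : Set ι} :
    (T.induce S).Connected ↔ S.Nonempty ∧ ∀ a ∈ S, ∀ b ∈ S, Linked T S a b := by
  constructor
  · intro h
    refine ⟨?_, fun a ha b hb => ?_⟩
    · obtain ⟨⟨x, hx⟩⟩ := h.nonempty
      exact ⟨x, hx⟩
    · have hr := (reachable_iff_reflTransGen _ _).1 (h.preconnected ⟨a, ha⟩ ⟨b, hb⟩)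
      have key : ∀ (u v : S), Relation.ReflTransGen (T.induce S).Adj u v →
          Linked T S u.1 v.1 := by
        intro u v huv
        induction huv with
        | refl => exact Linked.refl _
        | tail _ hvw ih => exact ih.tail (by simpa using hvw) (Subtype.coe_prop _) (Subtype.coe_prop _)
      exact key _ _ hr
  · rintro ⟨⟨x, hx⟩, h⟩
    have key : ∀ a b (ha : a ∈ S) (hb : b ∈ S), (T.induce S).Reachable ⟨a, ha⟩ ⟨b, hb⟩ := by
      intro a b ha hb
      have hl := h a ha b hb
      induction hl with
      | refl => exact Reachable.refl _
      | @tail c d _ hcd ih =>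
        exact (ih hcd.2.1).trans (Adj.reachable (by simpa using hcd.1) :
          (T.induce S).Reachable ⟨c, hcd.2.1⟩ ⟨d, hcd.2.2⟩)
    haveI : Nonempty S := ⟨⟨x, hx⟩⟩
    exact (connected_iff _).2 ⟨fun u v => key u.1 v.1 u.2 v.2, inferInstance⟩

/-- The node set of a vertex in a tree decomposition is linked through itself.
[cite: MarkovShi2008, §2 ((T3))] -/
theorem _root_.Literature.Combinatorics.SimpleGraph.TreeDecomposition.linked {V : Type*}
    {F : SimpleGraph V} (D : TreeDecomposition F ι) (x : V) {a b : ι} (ha : x ∈ D.bag a)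
    (hb : x ∈ D.bag b) : Linked D.tree {t | x ∈ D.bag t} a b :=
  (connected_induce_iff.1 (D.connected_induce x)).2 a ha b hb

end Linked

/-! ### C. Surgery on tree decompositions -/

section Surgery

variable {V V' ι ι' ι₁ ι₂ : Type*}

/-- The disjoint sum of two acyclic graphs is acyclic (a closed walk never changes sides).
[folklore] -/
theorem isAcyclic_sum {T₁ : SimpleGraph ι₁} {T₂ : SimpleGraph ι₂} (h₁ : T₁.IsAcyclic)
    (h₂ : T₂.IsAcyclic) : (T₁ ⊕g T₂).IsAcyclic := by
  rw [isAcyclic_iff_forall_adj_isBridge]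
  rintro (a | a) (b | b) hab
  · rw [isBridge_iff]
    intro hr
    have hab' : T₁.Adj a b := by simpa using hab
    have hbr := (isAcyclic_iff_forall_adj_isBridge.1 h₁ hab')
    rw [isBridge_iff] at hbr
    apply hbr
    -- project a walk avoiding the deleted edge to the left summand
    have key : ∀ (x y : ι₁ ⊕ ι₂) (w : ((T₁ ⊕g T₂).deleteEdges {s(Sum.inl a, Sum.inl b)}).Walk x y)
        (x' y' : ι₁), x = Sum.inl x' → y = Sum.inl y' →
        (T₁.deleteEdges {s(a, b)}).Reachable x' y' := by
      intro x y w
      induction w with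
      | nil =>
        rintro x' y' rfl h
        cases h
        rfl
      | @cons u v z huv _ ih =>
        rintro x' y' rfl rfl
        rcases v with v | v
        · have h1 : (T₁.deleteEdges {s(a, b)}).Adj x' v := by
            rw [deleteEdges_adj] at huv ⊢
            refine ⟨by simpa using huv.1, ?_⟩
            intro hmem
            apply huv.2
            simp only [Set.mem_singleton_iff] at hmem ⊢
            rcases Sym2.eq_iff.1 hmem with ⟨rfl, rfl⟩ | ⟨rfl, rfl⟩
            · rfl
            · exact Sym2.eq_swap
          exact h1.reachable.trans (ih v y' rfl rfl)
        · exact absurd huv.1 (by simp)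
    obtain ⟨w⟩ := hr
    exact key _ _ w a b rfl rfl
  · simp at hab
  · simp at hab
  · rw [isBridge_iff]
    intro hr
    have hab' : T₂.Adj a b := by simpa using hab
    have hbr := (isAcyclic_iff_forall_adj_isBridge.1 h₂ hab')
    rw [isBridge_iff] at hbr
    apply hbr
    have key : ∀ (x y : ι₁ ⊕ ι₂) (w : ((T₁ ⊕g T₂).deleteEdges {s(Sum.inr a, Sum.inr b)}).Walk x y)
        (x' y' : ι₂), x = Sum.inr x' → y = Sum.inr y' →
        (T₂.deleteEdges {s(a, b)}).Reachable x' y' := by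
      intro x y w
      induction w with
      | nil =>
        rintro x' y' rfl h
        cases h
        rfl
      | @cons u v z huv _ ih =>
        rintro x' y' rfl rfl
        rcases v with v | v
        · exact absurd huv.1 (by simp)
        · have h1 : (T₂.deleteEdges {s(a, b)}).Adj x' v := by
            rw [deleteEdges_adj] at huv ⊢
            refine ⟨by simpa using huv.1, ?_⟩
            intro hmem
            apply huv.2
            simp only [Set.mem_singleton_iff] at hmem ⊢
            rcases Sym2.eq_iff.1 hmem with ⟨rfl, rfl⟩ | ⟨rfl, rfl⟩
            · rfl
            · exact Sym2.eq_swap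
          exact h1.reachable.trans (ih v y' rfl rfl)
    obtain ⟨w⟩ := hr
    exact key _ _ w a b rfl rfl

/-- Joining two trees by one edge gives a tree. [folklore] -/
theorem isTree_sum_sup_edge {T₁ : SimpleGraph ι₁} {T₂ : SimpleGraph ι₂} (h₁ : T₁.IsTree)
    (h₂ : T₂.IsTree) (t₁ : ι₁) (t₂ : ι₂) :
    ((T₁ ⊕g T₂) ⊔ edge (Sum.inl t₁) (Sum.inr t₂)).IsTree :=
  ⟨h₁.1.sum_sup_edge h₂.1,
    (isAcyclic_sum h₁.2 h₂.2).sup_edge_of_not_reachable (not_reachable_sum_inl_inr t₁ t₂)⟩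

namespace Join

variable (F : SimpleGraph V) (T₁ : SimpleGraph ι₁) (T₂ : SimpleGraph ι₂)
  (b₁ : ι₁ → Finset V) (b₂ : ι₂ → Finset V) (t₁ : ι₁) (t₂ : ι₂)

/-- Hypotheses for joining two "half decompositions" `(T₁, b₁)`, `(T₂, b₂)` of one graph `F`
along a new tree edge `t₁ — t₂`: every edge of `F` lies in a bag; every vertex lies in a bag;
on each side the node set of a vertex is linked through itself; and a vertex occurring on both
sides occurs in both `b₁ t₁` and `b₂ t₂`. [folklore] -/
structure Hyp : Prop where
  /-- The first index graph is a tree. -/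
  isTree₁ : T₁.IsTree
  /-- The second index graph is a tree. -/
  isTree₂ : T₂.IsTree
  /-- Every edge of `F` lies in a bag of one side. -/
  cover : ∀ ⦃u v : V⦄, F.Adj u v → (∃ t, u ∈ b₁ t ∧ v ∈ b₁ t) ∨ (∃ t, u ∈ b₂ t ∧ v ∈ b₂ t)
  /-- Every vertex lies in some bag. -/
  mem : ∀ x : V, (∃ t, x ∈ b₁ t) ∨ (∃ t, x ∈ b₂ t)
  /-- On the first side, node sets of vertices are linked through themselves. -/
  linked₁ : ∀ (x : V) ⦃a b : ι₁⦄, x ∈ b₁ a → x ∈ b₁ b → Linked T₁ {t | x ∈ b₁ t} a b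
  /-- On the second side, node sets of vertices are linked through themselves. -/
  linked₂ : ∀ (x : V) ⦃a b : ι₂⦄, x ∈ b₂ a → x ∈ b₂ b → Linked T₂ {t | x ∈ b₂ t} a b
  /-- A vertex occurring on both sides occurs in both ends of the new tree edge. -/
  bridge : ∀ (x : V) ⦃a : ι₁⦄ ⦃b : ι₂⦄, x ∈ b₁ a → x ∈ b₂ b → x ∈ b₁ t₁ ∧ x ∈ b₂ t₂

variable {F T₁ T₂ b₁ b₂ t₁ t₂}

/-- **Joining two half decompositions along a tree edge** gives a tree decomposition indexed by
`ι₁ ⊕ ι₂` with the given bags. [folklore] -/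
def treeDecomposition (h : Hyp F T₁ T₂ b₁ b₂ t₁ t₂) : TreeDecomposition F (ι₁ ⊕ ι₂) where
  tree := (T₁ ⊕g T₂) ⊔ edge (Sum.inl t₁) (Sum.inr t₂)
  isTree := isTree_sum_sup_edge h.isTree₁ h.isTree₂ t₁ t₂
  bag := Sum.elim b₁ b₂
  exists_mem_bag_of_adj u v huv := by
    rcases h.cover huv with ⟨t, hu, hv⟩ | ⟨t, hu, hv⟩
    · exact ⟨Sum.inl t, hu, hv⟩
    · exact ⟨Sum.inr t, hu, hv⟩
  connected_induce x := by
    rw [connected_induce_iff]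
    have hL : ∀ ⦃a b : ι₁⦄, x ∈ b₁ a → x ∈ b₁ b →
        Linked ((T₁ ⊕g T₂) ⊔ edge (Sum.inl t₁) (Sum.inr t₂)) {t | x ∈ Sum.elim b₁ b₂ t}
          (Sum.inl a) (Sum.inl b) :=
      fun a b ha hb => (h.linked₁ x ha hb).map Sum.inl
        (fun u v _ _ huv => by rw [sup_adj]; left; simpa using huv) (fun u hu => hu)
    have hR : ∀ ⦃a b : ι₂⦄, x ∈ b₂ a → x ∈ b₂ b →
        Linked ((T₁ ⊕g T₂) ⊔ edge (Sum.inl t₁) (Sum.inr t₂)) {t | x ∈ Sum.elim b₁ b₂ t}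
          (Sum.inr a) (Sum.inr b) :=
      fun a b ha hb => (h.linked₂ x ha hb).map Sum.inr
        (fun u v _ _ huv => by rw [sup_adj]; left; simpa using huv) (fun u hu => hu)
    have hLR : ∀ ⦃a : ι₁⦄ ⦃b : ι₂⦄, x ∈ b₁ a → x ∈ b₂ b →
        Linked ((T₁ ⊕g T₂) ⊔ edge (Sum.inl t₁) (Sum.inr t₂)) {t | x ∈ Sum.elim b₁ b₂ t}
          (Sum.inl a) (Sum.inr b) := by
      intro a b ha hb
      obtain ⟨h1, h2⟩ := h.bridge x ha hb
      refine ((hL ha h1).tail ?_ h1 h2).trans (hR h2 hb)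
      rw [sup_adj]; right; simp [edge_adj]
    refine ⟨?_, ?_⟩
    · rcases h.mem x with ⟨t, ht⟩ | ⟨t, ht⟩
      · exact ⟨Sum.inl t, ht⟩
      · exact ⟨Sum.inr t, ht⟩
    · rintro (a | a) ha (b | b) hb
      · exact hL ha hb
      · exact hLR ha hb
      · exact (hLR hb ha).symm
      · exact hR ha hb

/-- The bags of the joined decomposition. [folklore] -/
@[simp] theorem treeDecomposition_bag (h : Hyp F T₁ T₂ b₁ b₂ t₁ t₂) :
    (treeDecomposition h).bag = Sum.elim b₁ b₂ := rfl

end Join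

/-- **Reindexing and transporting a tree decomposition**: along an equivalence `g` of index
types and an equivalence `e` of vertex types (the graph becomes `F.map e`). [folklore] -/
def _root_.Literature.Combinatorics.SimpleGraph.TreeDecomposition.transport {F : SimpleGraph V}
    (D : TreeDecomposition F ι) (e : V ≃ V') (g : ι ≃ ι') :
    TreeDecomposition (F.map e) ι' where
  tree := D.tree.map g
  isTree := by
    refine ⟨(Iso.map g D.tree).connected_iff.1 D.isTree.1, ?_⟩
    exact D.isTree.2.comap (Iso.map g D.tree).symm.toHom (Iso.map g D.tree).symm.injective
  bag t := (D.bag (g.symm t)).map e.toEmbedding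
  exists_mem_bag_of_adj u v huv := by
    obtain ⟨-, a, b, hab, rfl, rfl⟩ := huv
    obtain ⟨t, ha, hb⟩ := D.exists_mem_bag_of_adj hab
    refine ⟨g t, ?_, ?_⟩ <;> simp [ha, hb]
  connected_induce x := by
    rw [connected_induce_iff]
    obtain ⟨t, ht⟩ := D.exists_mem_bag (e.symm x)
    refine ⟨⟨g t, by simpa [Finset.mem_map_equiv] using ht⟩, fun a ha b hb => ?_⟩
    have ha' : e.symm x ∈ D.bag (g.symm a) := by simpa [Finset.mem_map_equiv] using ha
    have hb' : e.symm x ∈ D.bag (g.symm b) := by simpa [Finset.mem_map_equiv] using hb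
    have key := (D.linked (e.symm x) ha' hb').map g
      (T' := D.tree.map g) (S' := {t | x ∈ (D.bag (g.symm t)).map e.toEmbedding})
      (fun u v _ _ huv => (map_adj_apply (f := g.toEmbedding)).2 huv)
      (fun u hu => by simpa [Finset.mem_map_equiv] using hu)
    simpa using key

/-- Transport preserves bag sizes. [folklore] -/
@[simp] theorem _root_.Literature.Combinatorics.SimpleGraph.TreeDecomposition.card_bag_transport
    {F : SimpleGraph V} (D : TreeDecomposition F ι) (e : V ≃ V') (g : ι ≃ ι') (t : ι') :
    ((D.transport e g).bag t).card = (D.bag (g.symm t)).card := by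
  simp [TreeDecomposition.transport]

/-- Membership in transported bags. [folklore] -/
theorem _root_.Literature.Combinatorics.SimpleGraph.TreeDecomposition.mem_bag_transport
    {F : SimpleGraph V} (D : TreeDecomposition F ι) (e : V ≃ V') (g : ι ≃ ι') (t : ι') (x : V') :
    x ∈ (D.transport e g).bag t ↔ e.symm x ∈ D.bag (g.symm t) := by
  simp [TreeDecomposition.transport, Finset.mem_map_equiv]

/-- **Treewidth from any finitely indexed decomposition with small bags**: if a finite graph has
a tree decomposition (over any finite index type) all of whose bags have at most `w + 1`
vertices, then after transport along any equivalence `e : V ≃ Fin j` its treewidth is `≤ w`.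
[cite: MarkovShi2008, §2 (treewidth)] -/
theorem treewidth_map_le_of_card_bag_le [Fintype ι] {F : SimpleGraph V} (D : TreeDecomposition F ι)
    {w : ℕ} (hD : ∀ t, (D.bag t).card ≤ w + 1) {j : ℕ} (e : V ≃ Fin j) :
    treewidth (F.map e) ≤ w := by
  have D' := D.transport e (Fintype.equivFin ι)
  refine (treewidth_le_width (D.transport e (Fintype.equivFin ι))).trans
    (TreeDecomposition.width_le _ fun t => ?_)
  rw [TreeDecomposition.card_bag_transport]
  exact hD _

end Surgery

/-! ### D. More on links: gateways, components, leaves -/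

section Gateway

variable {ι : Type*} {T : SimpleGraph ι}

/-- The first step of a nontrivial link. [folklore] -/
theorem Linked.exists_adj {S : Set ι} {a b : ι} (h : Linked T S a b) (hab : a ≠ b) :
    ∃ c, T.Adj a c ∧ c ∈ S ∧ Linked T S c b := by
  rcases Relation.ReflTransGen.cases_head h with rfl | ⟨c, hac, hcb⟩
  · exact (hab rfl).elim
  · exact ⟨c, hac.1, hac.2.2, hcb⟩

/-- **Gateway lemma.** If `P₁`, `P₂` cover `S`, meet only in `s`, and every edge of `T` between
`P₁` and `P₂` has `s` as an end, then a link through `S` between two nodes of `P₁` can be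
rerouted through `S ∩ P₁` (excursions into `P₂` leave and return through `s`). [folklore] -/
theorem Linked.gateway {S P₁ P₂ : Set ι} {s : ι} (hS : S ⊆ P₁ ∪ P₂)
    (hP : ∀ x ∈ P₁, x ∈ P₂ → x = s) (hs₁ : s ∈ P₁)
    (hsep : ∀ x ∈ P₁, ∀ y ∈ P₂, T.Adj x y → x = s ∨ y = s) {a b : ι} (h : Linked T S a b)
    (ha : a ∈ P₁) (hb : b ∈ P₁) : Linked T (S ∩ P₁) a b := by
  have key : ∀ a', Linked T S a' b → (a' ∈ P₁ → Linked T (S ∩ P₁) a' b) ∧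
      (a' ∈ P₂ → a' ≠ s → a' ∈ S → Linked T (S ∩ P₁) s b) := by
    intro a' h'
    induction h' using Relation.ReflTransGen.head_induction_on with
    | refl =>
      exact ⟨fun _ => Linked.refl _, fun hb₂ hbs _ => (hbs (hP b hb hb₂)).elim⟩
    | @head a c hac _ ih =>
      obtain ⟨hadj, haS, hcS⟩ := hac
      refine ⟨fun haP => ?_, fun haP has _ => ?_⟩
      · by_cases hcP : c ∈ P₁
        · exact Relation.ReflTransGen.head ⟨hadj, ⟨haS, haP⟩, ⟨hcS, hcP⟩⟩ (ih.1 hcP)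
        · have hc₂ : c ∈ P₂ := (hS hcS).resolve_left hcP
          have hcs : c ≠ s := fun h => hcP (h ▸ hs₁)
          rcases hsep a haP c hc₂ hadj with rfl | h
          · exact ih.2 hc₂ hcs hcS
          · exact (hcs h).elim
      · by_cases hcs : c = s
        · subst hcs
          exact ih.1 hs₁
        · have hc₂ : c ∈ P₂ := by
            rcases hS hcS with hc₁ | hc₂
            · rcases hsep c hc₁ a haP hadj.symm with h | h
              · exact (hcs h).elim
              · exact (has h).elim
            · exact hc₂
          exact ih.2 hc₂ hcs hcS
  exact (key a h).1 ha

/-- **Crossing lemma.** Under the same separation hypotheses, a link from a node of `P₁ ∖ P₂`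
to a node of `P₂ ∖ P₁` passes through `s`. [folklore] -/
theorem Linked.gateway_mem {S P₁ P₂ : Set ι} {s : ι} (hS : S ⊆ P₁ ∪ P₂) (hs₁ : s ∈ P₁)
    (hsep : ∀ x ∈ P₁, ∀ y ∈ P₂, T.Adj x y → x = s ∨ y = s) {a b : ι} (h : Linked T S a b)
    (ha : a ∈ P₁) (hb : b ∉ P₁) : s ∈ S := by
  induction h with
  | refl => exact (hb ha).elim
  | @tail c d _ hcd ih =>
    obtain ⟨hadj, hcS, hdS⟩ := hcd
    by_cases hc : c ∈ P₁
    · have hd₂ : d ∈ P₂ := (hS hdS).resolve_left hb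
      rcases hsep c hc d hd₂ hadj with rfl | rfl
      · exact hcS
      · exact (hb hs₁).elim
    · exact ih hc

/-- **Last exit.** If `C ⊆ N ∖ {s}` is closed under adjacency inside `N ∖ {s}`, then a link
through `N` from `s` to a node outside `C` can be rerouted to avoid `C`. [folklore] -/
theorem Linked.avoid {N C : Set ι} {s : ι} (hC : ∀ x ∈ C, ∀ y ∈ N, y ≠ s → T.Adj x y → y ∈ C)
    {a : ι} (h : Linked T N s a) (ha : a ∉ C) : Linked T (N \ C) s a := by
  induction h with
  | refl => exact Linked.refl _
  | @tail c d _ hcd ih =>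
    obtain ⟨hadj, hcN, hdN⟩ := hcd
    by_cases hds : d = s
    · subst hds; exact Linked.refl _
    · have hcC : c ∉ C := fun hcC => ha (hC c hcC d hdN hds hadj)
      have hsC : s ∉ C := fun hsC => by
        have := (ih hcC).mem_left ⟨hcN, hcC⟩
        exact this.2 hsC
      exact (ih hcC).tail hadj ⟨hcN, hcC⟩ ⟨hdN, ha⟩

/-- In an acyclic graph, two neighbours of `s` that are linked while avoiding `s` coincide.
[folklore] -/
theorem eq_of_adj_of_linked [DecidableEq ι] (hT : T.IsAcyclic) {s t₁ t₂ : ι} (h₁ : T.Adj s t₁)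
    (h₂ : T.Adj s t₂) {S : Set ι} (hs : s ∉ S) (h : Linked T S t₁ t₂) : t₁ = t₂ := by
  by_contra hne
  obtain ⟨w, hw⟩ := h.exists_walk
  have hsw : s ∉ w.support := fun hmem => by
    rcases hw s hmem with h | h
    · exact hs h
    · exact h₁.ne h
  let q : T.Walk t₁ t₂ := Walk.cons h₁.symm (Walk.cons h₂ Walk.nil)
  have hq : q.IsPath := by
    refine (Walk.cons_isPath_iff _ _).2 ⟨(Walk.cons_isPath_iff _ _).2 ⟨Walk.IsPath.nil, ?_⟩, ?_⟩
    · simpa using h₂.ne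
    · simp [h₁.ne', hne]
  have huniq := hT.path_unique ⟨q, hq⟩ w.toPath
  have hmem : s ∈ (w.toPath : T.Walk t₁ t₂).support := by
    rw [← huniq]; simp [q]
  exact hsw (Walk.support_toPath_subset_support w hmem)

end Gateway

/-! ### E. Constrained homomorphism counts -/

section CCount

variable {V γ : Type*}

/-- A predicate on functions `V → γ` depends only on the coordinates in `S`. [folklore] -/
def DependsOn (P : (V → γ) → Prop) (S : Set V) : Prop :=
  ∀ ⦃g g' : V → γ⦄, (∀ x ∈ S, g x = g' x) → (P g ↔ P g')

/-- `mix S g f` is `g` on `S` and `f` off `S`. [folklore] -/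
def mix [DecidableEq V] (S : Finset V) (g f : V → γ) : V → γ := fun x => if x ∈ S then g x else f x

/-- [folklore] -/
theorem mix_of_mem [DecidableEq V] {S : Finset V} {g f : V → γ} {x : V} (hx : x ∈ S) :
    mix S g f x = g x := if_pos hx

/-- [folklore] -/
theorem mix_of_not_mem [DecidableEq V] {S : Finset V} {g f : V → γ} {x : V} (hx : x ∉ S) :
    mix S g f x = f x := if_neg hx

/-- [folklore] -/
theorem mix_mix_mix [DecidableEq V] (S : Finset V) (g f : V → γ) :
    mix S (mix S g f) (mix S f g) = g := by
  funext x; by_cases hx : x ∈ S <;> simp [mix, hx]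

/-- **Independent coordinates multiply**: if `P₁` depends only on the coordinates in `S` and
`P₂` only on those off `S`, then `#{P₁ ∧ P₂} · #(V → γ) = #P₁ · #P₂`. [folklore] -/
theorem card_and_mul_card_fun [DecidableEq V] {P₁ P₂ : (V → γ) → Prop} {S : Finset V}
    (h₁ : DependsOn P₁ ↑S) (h₂ : DependsOn P₂ (↑S)ᶜ) :
    Nat.card {g // P₁ g ∧ P₂ g} * Nat.card (V → γ) =
      Nat.card {g // P₁ g} * Nat.card {g // P₂ g} := by
  rw [← Nat.card_prod, ← Nat.card_prod]
  have hS : ∀ g f : V → γ, ∀ x ∈ (↑S : Set V), mix S g f x = g x :=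
    fun g f x hx => mix_of_mem hx
  have hS' : ∀ g f : V → γ, ∀ x ∈ (↑S : Set V)ᶜ, mix S f g x = g x :=
    fun g f x hx => mix_of_not_mem hx
  refine Nat.card_congr
    { toFun := fun gf => (⟨mix S gf.1.1 gf.2, (h₁ (hS _ _)).2 gf.1.2.1⟩,
        ⟨mix S gf.2 gf.1.1, (h₂ (hS' _ _)).2 gf.1.2.2⟩)
      invFun := fun gg => (⟨mix S gg.1.1 gg.2.1, (h₁ (hS _ _)).2 gg.1.2, (h₂ (hS' _ _)).2 gg.2.2⟩,
        mix S gg.2.1 gg.1.1)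
      left_inv := ?_
      right_inv := ?_ }
  · rintro ⟨⟨g, hg⟩, f⟩
    simp only [mix_mix_mix]
  · rintro ⟨⟨g₁, hg₁⟩, ⟨g₂, hg₂⟩⟩
    simp only [mix_mix_mix]

/-- `IsHom F G` depends only on the coordinates carrying edges of `F`. [folklore] -/
theorem dependsOn_isHom {F : SimpleGraph V} {G : SimpleGraph γ} {W : Set V}
    (hW : ∀ ⦃a b⦄, F.Adj a b → a ∈ W ∧ b ∈ W) : DependsOn (IsHom F G) W := by
  intro g g' hgg'
  constructor
  · intro h a b hab
    rw [← hgg' a (hW hab).1, ← hgg' b (hW hab).2]; exact h hab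
  · intro h a b hab
    rw [hgg' a (hW hab).1, hgg' b (hW hab).2]; exact h hab

/-- The **constrained homomorphism count** `ccount F G X v`: the number of homomorphisms
`F → G` (as functions on all of `V`) that agree with `v` on `X`. [folklore] -/
noncomputable def ccount (F : SimpleGraph V) (G : SimpleGraph γ) (X : Finset V) (v : V → γ) : ℕ :=
  Nat.card {g : V → γ // IsHom F G g ∧ ∀ x ∈ X, g x = v x}

variable {F : SimpleGraph V} {G : SimpleGraph γ}

/-- With no constraint, `ccount` counts `F →g G`. [folklore] -/
theorem ccount_empty (F : SimpleGraph V) (G : SimpleGraph γ) (v : V → γ) :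
    ccount F G ∅ v = Nat.card (F →g G) := by
  rw [card_hom_eq_card_subtype]
  exact Nat.card_congr (Equiv.subtypeEquivRight fun g => by simp)

/-- `ccount` only sees the constraint on `X`. [folklore] -/
theorem ccount_congr {X : Finset V} {v v' : V → γ} (h : ∀ x ∈ X, v x = v' x) :
    ccount F G X v = ccount F G X v' :=
  Nat.card_congr (Equiv.subtypeEquivRight fun g =>
    and_congr_right fun _ => forall₂_congr fun x hx => by rw [h x hx])

/-- Changing the predicate of `ccount` up to equivalence. [folklore] -/
theorem ccount_eq_card_of_iff {X : Finset V} {v : V → γ} {P : (V → γ) → Prop}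
    (h : ∀ g, (IsHom F G g ∧ ∀ x ∈ X, g x = v x) ↔ P g) :
    ccount F G X v = Nat.card {g // P g} :=
  Nat.card_congr (Equiv.subtypeEquivRight h)

/-- **Fibre sum**: constraining one more vertex `y` and summing over its value. [folklore] -/
theorem ccount_eq_sum_insert [Finite V] [Fintype γ] [DecidableEq V] [DecidableEq γ] {X : Finset V}
    {y : V} (hy : y ∉ X) (v : V → γ) :
    ccount F G X v = ∑ a, ccount F G (insert y X) (Function.update v y a) := by
  classical
  unfold ccount
  rw [← Nat.card_sigma]
  refine Nat.card_congr ?_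
  refine (Equiv.sigmaFiberEquiv (fun g : {g : V → γ // IsHom F G g ∧ ∀ x ∈ X, g x = v x} =>
    g.1 y)).symm.trans (Equiv.sigmaCongrRight fun a => ?_)
  exact
    { toFun := fun g => ⟨g.1.1, g.1.2.1, fun x hx => by
        rcases Finset.mem_insert.1 hx with rfl | hx
        · rw [Function.update_self]; exact g.2
        · rw [Function.update_of_ne (ne_of_mem_of_not_mem hx hy)]; exact g.1.2.2 x hx⟩
      invFun := fun g => ⟨⟨g.1, g.2.1, fun x hx => by
        rw [g.2.2 x (Finset.mem_insert_of_mem hx),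
          Function.update_of_ne (ne_of_mem_of_not_mem hx hy)]⟩,
        by rw [g.2.2 y (Finset.mem_insert_self _ _), Function.update_self]⟩
      left_inv := fun g => rfl
      right_inv := fun g => rfl }

/-- A violated constraint kills the count. [folklore] -/
theorem ccount_eq_zero {X : Finset V} {v : V → γ} {a b : V} (ha : a ∈ X) (hb : b ∈ X)
    (hab : F.Adj a b) (hG : ¬ G.Adj (v a) (v b)) : ccount F G X v = 0 := by
  unfold ccount
  rw [Nat.card_eq_zero]
  left
  refine ⟨fun g => hG ?_⟩
  rw [← g.2.2 a ha, ← g.2.2 b hb]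
  exact g.2.1 hab

/-- `killIn F Z`: `F` with the edges inside `Z` deleted. [folklore] -/
def killIn (F : SimpleGraph V) (Z : Finset V) : SimpleGraph V where
  Adj a b := F.Adj a b ∧ ¬ (a ∈ Z ∧ b ∈ Z)
  symm := ⟨fun _ _ h => ⟨h.1.symm, fun h' => h.2 ⟨h'.2, h'.1⟩⟩⟩
  loopless := ⟨fun _ h => F.irrefl h.1⟩

/-- [folklore] -/
theorem killIn_adj {F : SimpleGraph V} {Z : Finset V} {a b : V} :
    (killIn F Z).Adj a b ↔ F.Adj a b ∧ ¬ (a ∈ Z ∧ b ∈ Z) := Iff.rfl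

/-- [folklore] -/
theorem killIn_le (F : SimpleGraph V) (Z : Finset V) : killIn F Z ≤ F := fun _ _ h => (killIn_adj.1 h).1

/-- **Localising edges**: if the constraint respects the edges inside `Z ⊆ X`, these edges can
be deleted without changing the count. [folklore] -/
theorem ccount_killIn {X Z : Finset V} (hZX : Z ⊆ X) {v : V → γ}
    (hgood : ∀ a ∈ Z, ∀ b ∈ Z, F.Adj a b → G.Adj (v a) (v b)) :
    ccount F G X v = ccount (killIn F Z) G X v := by
  refine Nat.card_congr (Equiv.subtypeEquivRight fun g => and_congr_left fun hg => ?_)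
  constructor
  · exact fun h => h.anti (killIn_le F Z)
  · intro h a b hab
    by_cases hZ : a ∈ Z ∧ b ∈ Z
    · rw [hg a (hZX hZ.1), hg b (hZX hZ.2)]; exact hgood a hZ.1 b hZ.2 hab
    · exact h (killIn_adj.2 ⟨hab, hZ⟩)

/-- Out of the edgeless graph, `ccount` counts the free coordinates. [folklore] -/
theorem ccount_bot [Fintype V] [DecidableEq V] [Fintype γ] (X : Finset V) (v : V → γ) :
    ccount (⊥ : SimpleGraph V) G X v = Fintype.card γ ^ Xᶜ.card := by
  classical
  unfold ccount
  rw [← Fintype.card_coe, ← Fintype.card_fun, ← Nat.card_eq_fintype_card]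
  refine Nat.card_congr
    { toFun := fun g x => g.1 x.1
      invFun := fun f => ⟨fun x => if hx : x ∈ X then v x else f ⟨x, Finset.mem_compl.2 hx⟩,
        isHom_bot G _, fun x hx => by simp [hx]⟩
      left_inv := ?_
      right_inv := ?_ }
  · rintro ⟨g, hg⟩
    ext x
    by_cases hx : x ∈ X
    · simp [hx, hg.2 x hx]
    · simp [hx]
  · intro f
    funext x
    have hx : x.1 ∉ X := Finset.mem_compl.1 x.2
    simp [hx]

/-- The number of functions with prescribed values on `X`. [folklore] -/
theorem card_eqOn [Fintype V] [DecidableEq V] [Fintype γ] (X : Finset V) (v : V → γ) :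
    Nat.card {g : V → γ // ∀ x ∈ X, g x = v x} = Fintype.card γ ^ Xᶜ.card := by
  rw [← ccount_bot (G := (⊥ : SimpleGraph γ)) X v]
  exact (ccount_eq_card_of_iff fun g => by simp [IsHom]).symm

/-- [folklore] -/
theorem mix_eq_self [DecidableEq V] {X : Finset V} {v g : V → γ} (h : ∀ x ∈ X, g x = v x) :
    mix X v g = g := by
  funext x; by_cases hx : x ∈ X <;> simp [mix, hx, h]

/-- **Freeing isolated constrained vertices**: if every vertex of `P` is isolated in `F`, then
constraining `P` in addition to `X'` divides the count by `|γ| ^ |P|` (stated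
multiplicatively). [folklore] -/
theorem ccount_union_mul [Fintype V] [DecidableEq V] [Fintype γ] {X' P : Finset V}
    (hdisj : Disjoint X' P) (hiso : ∀ y ∈ P, ∀ z, ¬ F.Adj y z) (v : V → γ) :
    ccount F G (X' ∪ P) v * Nat.card (V → γ) = Fintype.card γ ^ Pᶜ.card * ccount F G X' v := by
  classical
  have h1 : DependsOn (fun g : V → γ => ∀ x ∈ P, g x = v x) ↑P := fun g g' hgg' =>
    forall₂_congr fun x hx => by rw [hgg' x hx]
  have h2 : DependsOn (fun g : V → γ => IsHom F G g ∧ ∀ x ∈ X', g x = v x) (↑P)ᶜ := by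
    intro g g' hgg'
    refine and_congr (dependsOn_isHom ?_ hgg') (forall₂_congr fun x hx => ?_)
    · intro a b hab
      exact ⟨fun ha => hiso a ha b hab, fun hb => hiso b hb a hab.symm⟩
    · rw [hgg' x (fun hxP => Finset.disjoint_left.1 hdisj hx hxP)]
  have key := card_and_mul_card_fun h1 h2
  rw [card_eqOn] at key
  rw [show ccount F G X' v = Nat.card {g // IsHom F G g ∧ ∀ x ∈ X', g x = v x} from rfl, ← key]
  congr 1
  refine ccount_eq_card_of_iff fun g => ⟨?_, ?_⟩
  · rintro ⟨hg, hgX⟩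
    exact ⟨fun x hx => hgX x (Finset.mem_union_right _ hx), hg,
      fun x hx => hgX x (Finset.mem_union_left _ hx)⟩
  · rintro ⟨hgP, hg, hgX'⟩
    refine ⟨hg, fun x hx => ?_⟩
    rcases Finset.mem_union.1 hx with hx | hx
    · exact hgX' x hx
    · exact hgP x hx

/-- **Multiplicativity over a separation**: if the edges of `F₁` live on `W ∪ X`, the edges of
`F₂` avoid `W`, and `W` is disjoint from the constrained set `X`, then (up to the free-coordinate
factors) `ccount (F₁ ⊔ F₂) = ccount F₁ · ccount F₂`. [folklore] -/
theorem ccount_sup_mul [Fintype V] [DecidableEq V] [Fintype γ] {F₁ F₂ : SimpleGraph V}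
    {X W : Finset V} (h₁ : ∀ ⦃a b⦄, F₁.Adj a b → (a ∈ W ∨ a ∈ X) ∧ (b ∈ W ∨ b ∈ X))
    (h₂ : ∀ ⦃a b⦄, F₂.Adj a b → a ∉ W ∧ b ∉ W) (hWX : Disjoint W X) (v : V → γ) :
    ccount (F₁ ⊔ F₂) G X v * Fintype.card γ ^ Xᶜ.card * Nat.card (V → γ) =
      ccount F₁ G X v * ccount F₂ G X v * Nat.card (V → γ) := by
  classical
  set Q₁ : (V → γ) → Prop := fun g => IsHom F₁ G (mix X v g) with hQ₁def
  have hQ₁ : DependsOn Q₁ ↑W := by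
    intro g g' hgg'
    apply dependsOn_isHom (F := F₁) (G := G) (W := (↑W ∪ ↑X : Set V))
    · intro a b hab
      obtain ⟨ha, hb⟩ := h₁ hab
      exact ⟨by simpa using ha, by simpa using hb⟩
    · intro x hx
      by_cases hxX : x ∈ X
      · rw [mix_of_mem hxX, mix_of_mem hxX]
      · rw [mix_of_not_mem hxX, mix_of_not_mem hxX]
        rcases hx with hx | hx
        · exact hgg' x hx
        · exact (hxX hx).elim
  have hXW : ∀ x ∈ X, x ∈ (↑W : Set V)ᶜ := fun x hx hxW => Finset.disjoint_left.1 hWX hxW hx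
  have hQ₂ : DependsOn (fun g => IsHom F₂ G g ∧ ∀ x ∈ X, g x = v x) (↑W)ᶜ := by
    intro g g' hgg'
    refine and_congr (dependsOn_isHom (fun a b hab => ?_) hgg')
      (forall₂_congr fun x hx => by rw [hgg' x (hXW x hx)])
    exact ⟨(h₂ hab).1, (h₂ hab).2⟩
  have hQ₃ : DependsOn (fun g : V → γ => ∀ x ∈ X, g x = v x) (↑W)ᶜ := fun g g' hgg' =>
    forall₂_congr fun x hx => by rw [hgg' x (hXW x hx)]
  have e1 := card_and_mul_card_fun hQ₁ hQ₂
  have e2 := card_and_mul_card_fun hQ₁ hQ₃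
  rw [card_eqOn] at e2
  have i1 : ccount (F₁ ⊔ F₂) G X v =
      Nat.card {g // Q₁ g ∧ (IsHom F₂ G g ∧ ∀ x ∈ X, g x = v x)} := by
    refine ccount_eq_card_of_iff fun g => ?_
    rw [isHom_sup_iff]
    constructor
    · rintro ⟨⟨hg₁, hg₂⟩, hgX⟩
      exact ⟨show IsHom F₁ G (mix X v g) by rwa [mix_eq_self hgX], hg₂, hgX⟩
    · rintro ⟨hg₁, hg₂, hgX⟩
      exact ⟨⟨by simpa only [hQ₁def, mix_eq_self hgX] using hg₁, hg₂⟩, hgX⟩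
  have i2 : ccount F₁ G X v = Nat.card {g // Q₁ g ∧ ∀ x ∈ X, g x = v x} := by
    refine ccount_eq_card_of_iff fun g => ?_
    constructor
    · rintro ⟨hg₁, hgX⟩
      exact ⟨show IsHom F₁ G (mix X v g) by rwa [mix_eq_self hgX], hgX⟩
    · rintro ⟨hg₁, hgX⟩
      exact ⟨by simpa only [hQ₁def, mix_eq_self hgX] using hg₁, hgX⟩
  have i3 : ccount F₂ G X v = Nat.card {g // IsHom F₂ G g ∧ ∀ x ∈ X, g x = v x} := rfl
  rw [i1, i2, i3, mul_right_comm _ _ (Nat.card (V → γ)), e1, mul_right_comm _ _ (Nat.card (V → γ)),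
    e2]
  ring

end CCount

/-! ### F. From the game to homomorphism counts -/

section Forward

variable {V ι α β : Type*}

/-- A **partial tree decomposition** of `F` inside a fixed ambient forest `T` with fixed bags
`bg`: a set `N` of tree nodes, linked through itself, whose bags cover every edge of `F`, and
such that the nodes of `N` holding a given vertex are linked through themselves. (Vertices of
`F` in no bag of `N` are allowed; they are isolated.) [folklore] -/
structure PreDecomp (T : SimpleGraph ι) (bg : ι → Finset V) (F : SimpleGraph V) (N : Finset ι) :
    Prop where
  /-- The node set `N` is linked through itself. -/
  linked : ∀ ⦃a b : ι⦄, a ∈ N → b ∈ N → Linked T ↑N a b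
  /-- Every edge of `F` lies in a bag of `N`. -/
  cover : ∀ ⦃u v : V⦄, F.Adj u v → ∃ t ∈ N, u ∈ bg t ∧ v ∈ bg t
  /-- The nodes of `N` holding a vertex are linked through themselves. -/
  local_linked : ∀ (x : V) ⦃a b : ι⦄, a ∈ N → b ∈ N → x ∈ bg a → x ∈ bg b →
    Linked T {t | t ∈ N ∧ x ∈ bg t} a b

/-- [folklore] -/
theorem PreDecomp.anti {T : SimpleGraph ι} {bg : ι → Finset V} {F F' : SimpleGraph V}
    {N : Finset ι} (h : PreDecomp T bg F N) (hle : F' ≤ F) : PreDecomp T bg F' N :=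
  ⟨h.linked, fun _ _ huv => h.cover (hle huv), h.local_linked⟩

/-- A tree decomposition is a partial tree decomposition on all of its nodes.
[cite: MarkovShi2008, §2] -/
theorem PreDecomp.of_treeDecomposition [Fintype ι] {F : SimpleGraph V}
    (D : TreeDecomposition F ι) :
    PreDecomp D.tree D.bag F Finset.univ := by
  refine ⟨fun a b _ _ => ?_, fun u v huv => ?_, fun x a b _ _ hxa hxb => ?_⟩
  · simpa using Linked.of_reachable (D.isTree.1.preconnected a b)
  · obtain ⟨t, hu, hv⟩ := D.exists_mem_bag_of_adj huv
    exact ⟨t, Finset.mem_univ _, hu, hv⟩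
  · simpa using D.linked x hxa hxb

/-- The edges of `F` covered by a bag from `P`. [folklore] -/
def coveredBy (F : SimpleGraph V) (bg : ι → Finset V) (P : Finset ι) : SimpleGraph V where
  Adj u v := F.Adj u v ∧ ∃ t ∈ P, u ∈ bg t ∧ v ∈ bg t
  symm := ⟨fun _ _ h => ⟨h.1.symm, let ⟨t, ht, hu, hv⟩ := h.2; ⟨t, ht, hv, hu⟩⟩⟩
  loopless := ⟨fun _ h => F.irrefl h.1⟩

/-- [folklore] -/
theorem coveredBy_adj {F : SimpleGraph V} {bg : ι → Finset V} {P : Finset ι} {u v : V} :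
    (coveredBy F bg P).Adj u v ↔ F.Adj u v ∧ ∃ t ∈ P, u ∈ bg t ∧ v ∈ bg t := Iff.rfl

variable [Fintype V] [DecidableEq V] [DecidableEq ι] [Fintype α] [DecidableEq α] [Fintype β]
  [DecidableEq β]

/-- **Main lemma of the direction game ⇒ hom counts** (the game-theoretic form of Dvořák's
Lemma 3): along the positions of a winning strategy for Duplicator, the constrained homomorphism
counts into `G` and into `H` of any graph carrying a partial tree decomposition with bags of
size `≤ k`, constrained on part of one bag, agree. Induction on
`|N| · (|V| + 1) + |V ∖ X|`; cases: extend the constraint inside the bag (one forth move),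
a single bag (partial isomorphism), the apex is a leaf (drop it), split at the apex
(multiplicativity). [cite: Dvorak2010, Lemma 3 (game form)] -/
theorem forward_main {k : ℕ} {G : SimpleGraph α} {H : SimpleGraph β} (𝒮 : BijPebbleStrategy k G H)
    (hcard : Fintype.card α = Fintype.card β) [Nonempty α]
    {T : SimpleGraph ι} (hT : T.IsAcyclic) {bg : ι → Finset V} (hbg : ∀ t, (bg t).card ≤ k) :
    ∀ (μ : ℕ) (F : SimpleGraph V) (N : Finset ι) (s : ι) (X : Finset V),
      PreDecomp T bg F N → s ∈ N → X ⊆ bg s → N.card * (Fintype.card V + 1) + Xᶜ.card < μ →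
      ∀ ⦃p : Set (α × β)⦄, p ∈ 𝒮.carrier → ∀ (u : V → α × β), (∀ x ∈ X, u x ∈ p) →
        ccount F G X (fun x => (u x).1) = ccount F H X (fun x => (u x).2) := by
  classical
  intro μ
  induction μ with
  | zero => intro _ _ _ _ _ _ _ hμ; exact (Nat.not_lt_zero _ hμ).elim
  | succ μ ih =>
  intro F N s X hD hs hX hμ p hp u hu
  have hApos : 0 < Fintype.card α := Fintype.card_pos
  by_cases hfull : ∃ y ∈ bg s, y ∉ X
  · /- case (i): extend the constraint to one more vertex of the bag: one forth move -/
    obtain ⟨y, hys, hyX⟩ := hfull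
    set q : Set (α × β) := u '' ↑X with hq
    have hqp : q ⊆ p := by rintro _ ⟨x, hx, rfl⟩; exact hu x hx
    have hqS : q ∈ 𝒮.carrier := 𝒮.mem_of_subset hp hqp
    have hqcard : q.ncard < k := by
      calc q.ncard ≤ (↑X : Set V).ncard := Set.ncard_image_le (Finset.finite_toSet X)
        _ = X.card := Set.ncard_coe_finset X
        _ < (bg s).card := Finset.card_lt_card ⟨hX, fun h => hyX (h hys)⟩
        _ ≤ k := hbg s
    obtain ⟨f, hf⟩ := 𝒮.forth hqS hqcard
    rw [ccount_eq_sum_insert hyX, ccount_eq_sum_insert hyX]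
    refine Fintype.sum_equiv f _ _ fun a => ?_
    have hμ' : N.card * (Fintype.card V + 1) + (insert y X)ᶜ.card < μ := by
      have h1 := Finset.card_compl X
      have h2 := Finset.card_compl (insert y X)
      have h3 := Finset.card_insert_of_notMem hyX
      have h4 := Finset.card_le_univ (insert y X)
      omega
    have key := ih F N s (insert y X) hD hs (Finset.insert_subset hys hX) hμ' (hf a)
      (Function.update u y (a, f a)) ?_
    · rw [ccount_congr (v' := fun x => (Function.update u y (a, f a) x).1), key, ccount_congr]
      · intro x _
        by_cases hxy : x = y
        · subst hxy; simp
        · simp [Function.update_of_ne hxy]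
      · intro x _
        by_cases hxy : x = y
        · subst hxy; simp
        · simp [Function.update_of_ne hxy]
    · intro x hx
      rcases Finset.mem_insert.1 hx with rfl | hx
      · simp
      · rw [Function.update_of_ne (ne_of_mem_of_not_mem hx hyX)]
        exact Set.mem_insert_of_mem _ ⟨x, hx, rfl⟩
  /- case (ii): the whole bag is constrained -/
  push Not at hfull
  have hXeq : X = bg s := Finset.Subset.antisymm hX hfull
  have hiso := 𝒮.isPartialIso_of_mem hp
  by_cases hbad : ∃ a ∈ X, ∃ b ∈ X, F.Adj a b ∧ ¬ G.Adj (u a).1 (u b).1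
  · obtain ⟨a, ha, b, hb, hab, hG⟩ := hbad
    have hH : ¬ H.Adj (u a).2 (u b).2 := fun h => hG ((hiso.adj_iff (hu a ha) (hu b hb)).2 h)
    rw [ccount_eq_zero ha hb hab hG, ccount_eq_zero ha hb hab hH]
  push Not at hbad
  have hgoodG : ∀ a ∈ X, ∀ b ∈ X, F.Adj a b → G.Adj (u a).1 (u b).1 := hbad
  have hgoodH : ∀ a ∈ X, ∀ b ∈ X, F.Adj a b → H.Adj (u a).2 (u b).2 :=
    fun a ha b hb hab => (hiso.adj_iff (hu a ha) (hu b hb)).1 (hgoodG a ha b hb hab)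
  rw [ccount_killIn (subset_refl X) hgoodG, ccount_killIn (subset_refl X) hgoodH]
  set F' := killIn F X with hF'
  have hD' : PreDecomp T bg F' N := hD.anti (killIn_le F X)
  have hF'X : ∀ a b, F'.Adj a b → ¬ (a ∈ X ∧ b ∈ X) := fun a b h => (killIn_adj.1 h).2
  by_cases hN : ∃ t ∈ N, t ≠ s
  swap
  · /- case (ii-a): a single bag; no edges are left -/
    push Not at hN
    have hbot : F' = ⊥ := by
      ext a b
      simp only [bot_adj, iff_false]
      intro hab
      obtain ⟨t, ht, hat, hbt⟩ := hD'.cover hab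
      rw [hN t ht] at hat hbt
      exact hF'X a b hab ⟨hXeq ▸ hat, hXeq ▸ hbt⟩
    rw [hbot, ccount_bot, ccount_bot, hcard]
  obtain ⟨t, htN, hts⟩ := hN
  obtain ⟨t₁, hst₁, ht₁N, -⟩ := (hD.linked hs htN).exists_adj (Ne.symm hts)
  set N' := N.erase s with hN'
  have ht₁N' : t₁ ∈ N' := Finset.mem_erase.2 ⟨hst₁.ne', ht₁N⟩
  have hsN' : s ∉ N' := fun h => (Finset.mem_erase.1 h).1 rfl
  have hN'N : N' ⊆ N := Finset.erase_subset _ _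
  set C := N'.filter (fun x => Linked T ↑N' t₁ x) with hC
  have hCN' : C ⊆ N' := Finset.filter_subset _ _
  have ht₁C : t₁ ∈ C := Finset.mem_filter.2 ⟨ht₁N', Linked.refl _⟩
  have hCclosed : ∀ x ∈ C, ∀ y ∈ N', T.Adj x y → y ∈ C := fun x hx y hy hxy =>
    Finset.mem_filter.2 ⟨hy, (Finset.mem_filter.1 hx).2.tail hxy (hCN' hx) hy⟩
  by_cases hleaf : ∀ x ∈ N', x ∈ C
  · /- case (ii-b): `s` is a leaf of `N` with unique neighbour `t₁`; drop `s` -/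
    have huniq : ∀ t₂ ∈ N, T.Adj s t₂ → t₂ = t₁ := by
      intro t₂ ht₂ hst₂
      have ht₂N' : t₂ ∈ N' := Finset.mem_erase.2 ⟨hst₂.ne', ht₂⟩
      exact (eq_of_adj_of_linked hT hst₁ hst₂ hsN' (Finset.mem_filter.1 (hleaf t₂ ht₂N')).2).symm
    have hD'' : PreDecomp T bg F' N' := by
      refine ⟨fun a b ha hb => ?_, fun a b hab => ?_, fun x a b ha hb hxa hxb => ?_⟩
      · exact (Finset.mem_filter.1 (hleaf a ha)).2.symm.trans (Finset.mem_filter.1 (hleaf b hb)).2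
      · obtain ⟨t, ht, hat, hbt⟩ := hD'.cover hab
        refine ⟨t, Finset.mem_erase.2 ⟨?_, ht⟩, hat, hbt⟩
        rintro rfl
        exact hF'X a b hab ⟨hXeq ▸ hat, hXeq ▸ hbt⟩
      · have hl := hD'.local_linked x (hN'N ha) (hN'N hb) hxa hxb
        have key := hl.gateway (P₁ := (↑N' : Set ι)) (P₂ := ({s, t₁} : Set ι)) (s := t₁)
          ?_ ?_ ht₁N' ?_ ha hb
        · refine key.mono ?_
          rintro t ⟨⟨-, hxt⟩, htN'⟩
          exact ⟨htN', hxt⟩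
        · rintro t ⟨htN, -⟩
          by_cases hts : t = s
          · exact Or.inr (by simp [hts])
          · exact Or.inl (Finset.mem_erase.2 ⟨hts, htN⟩)
        · intro t ht ht'
          rcases ht' with rfl | rfl
          · exact absurd ht hsN'
          · rfl
        · intro c hc d hd hcd
          rcases hd with rfl | rfl
          · exact Or.inl (huniq c (hN'N hc) hcd.symm)
          · exact Or.inr rfl
    set X' := X ∩ bg t₁ with hX'
    set P := X \ bg t₁ with hP
    have hXsplit : X' ∪ P = X := by rw [Finset.union_comm]; exact Finset.sdiff_union_inter X (bg t₁)
    have hdisj : Disjoint X' P := by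
      rw [Finset.disjoint_left]
      intro x hx hxP
      exact (Finset.mem_sdiff.1 hxP).2 (Finset.mem_inter.1 hx).2
    have hPiso : ∀ y ∈ P, ∀ z, ¬ F'.Adj y z := by
      intro y hy z hyz
      obtain ⟨hyX, hyt₁⟩ := Finset.mem_sdiff.1 hy
      obtain ⟨t, ht, hyt, hzt⟩ := hD'.cover hyz
      by_cases hts : t = s
      · subst hts
        exact hF'X y z hyz ⟨hyX, hXeq ▸ hzt⟩
      · have hys : y ∈ bg s := hXeq ▸ hyX
        have hl := hD'.local_linked y hs ht hys hyt
        obtain ⟨c, hsc, hc, -⟩ := hl.exists_adj (Ne.symm hts)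
        have := huniq c hc.1 hsc
        subst this
        exact hyt₁ hc.2
    have hμ' : N'.card * (Fintype.card V + 1) + X'ᶜ.card < μ := by
      have h1 : N'.card + 1 = N.card := Finset.card_erase_add_one hs
      have h2 : X'ᶜ.card ≤ Fintype.card V := Finset.card_le_univ _
      have h3 : N.card * (Fintype.card V + 1) =
          N'.card * (Fintype.card V + 1) + (Fintype.card V + 1) := by rw [← h1]; ring
      omega
    have keyIH := ih F' N' t₁ X' hD'' ht₁N' Finset.inter_subset_right hμ' hp u
      (fun x hx => hu x (Finset.mem_inter.1 hx).1)
    have eG := ccount_union_mul (G := G) hdisj hPiso (fun x => (u x).1)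
    have eH := ccount_union_mul (G := H) hdisj hPiso (fun x => (u x).2)
    rw [hXsplit] at eG eH
    rw [Nat.card_fun, Nat.card_eq_fintype_card, Nat.card_eq_fintype_card] at eG eH
    rw [keyIH, hcard, ← eH] at eG
    exact Nat.eq_of_mul_eq_mul_right (pow_pos (hcard ▸ hApos) _) eG
  · /- case (ii-c): split `N` at `s` into the component of `t₁` (plus `s`) and the rest -/
    push Not at hleaf
    obtain ⟨t₂, ht₂N', ht₂C⟩ := hleaf
    set P₁ := insert s C with hP₁
    set P₂ := N \ C with hP₂
    have hsC : s ∉ C := fun h => hsN' (hCN' h)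
    have hP₁N : P₁ ⊆ N := Finset.insert_subset hs (hCN'.trans hN'N)
    have hP₂N : P₂ ⊆ N := Finset.sdiff_subset
    have hsP₁ : s ∈ P₁ := Finset.mem_insert_self _ _
    have hsP₂ : s ∈ P₂ := Finset.mem_sdiff.2 ⟨hs, hsC⟩
    have hcoverN : ∀ t ∈ N, t ∈ P₁ ∨ t ∈ P₂ := fun t ht =>
      if h : t ∈ C then Or.inl (Finset.mem_insert_of_mem h) else Or.inr (Finset.mem_sdiff.2 ⟨ht, h⟩)
    have hmeet : ∀ t ∈ P₁, t ∈ P₂ → t = s := by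
      intro t ht₁ ht₂
      rcases Finset.mem_insert.1 ht₁ with rfl | htC
      · rfl
      · exact ((Finset.mem_sdiff.1 ht₂).2 htC).elim
    have hsep : ∀ x ∈ P₁, ∀ y ∈ P₂, T.Adj x y → x = s ∨ y = s := by
      intro x hx y hy hxy
      rcases Finset.mem_insert.1 hx with rfl | hxC
      · exact Or.inl rfl
      · by_cases hys : y = s
        · exact Or.inr hys
        · exact ((Finset.mem_sdiff.1 hy).2
            (hCclosed x hxC y (Finset.mem_erase.2 ⟨hys, (Finset.mem_sdiff.1 hy).1⟩) hxy)).elim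
    have hsep' : ∀ x ∈ P₂, ∀ y ∈ P₁, T.Adj x y → x = s ∨ y = s := fun x hx y hy hxy =>
      (hsep y hy x hx hxy.symm).symm
    -- a vertex in a `P₁`-bag and in a `P₂`-bag lies in `X = bg s`
    have hW : ∀ (a : V), ∀ t ∈ P₂, a ∈ bg t → ∀ t' ∈ P₁, a ∈ bg t' → a ∈ X := by
      intro a t ht hat t' ht' hat'
      by_cases h2 : t ∈ P₁
      · rw [hmeet t h2 ht] at hat; rwa [hXeq]
      have hl := hD.local_linked a (hP₁N ht') (hP₂N ht) hat' hat
      have hsS := hl.gateway_mem (P₁ := (↑P₁ : Set ι)) (P₂ := (↑P₂ : Set ι)) (s := s) ?_ hsP₁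
        hsep ht' h2
      · rw [hXeq]; exact hsS.2
      · rintro x ⟨hx, -⟩; exact hcoverN x hx
    set F₁ := coveredBy F' bg P₁ with hF₁
    set F₂ := coveredBy F' bg P₂ with hF₂
    have hF'eq : F' = F₁ ⊔ F₂ := by
      ext a b
      constructor
      · intro hab
        obtain ⟨t, ht, hat, hbt⟩ := hD'.cover hab
        rcases hcoverN t ht with ht | ht
        · exact Or.inl ⟨hab, t, ht, hat, hbt⟩
        · exact Or.inr ⟨hab, t, ht, hat, hbt⟩
      · rintro (h | h)
        · exact h.1
        · exact h.1
    have hlinkC : ∀ x ∈ C, Linked T ↑C t₁ x := by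
      intro x hx
      have hl : Linked T ↑N' t₁ x := (Finset.mem_filter.1 hx).2
      clear hx
      induction hl with
      | refl => exact Linked.refl _
      | @tail c d hpre hcd ih' =>
        exact ih'.tail hcd.1 (Finset.mem_filter.2 ⟨hcd.2.1, hpre⟩)
          (Finset.mem_filter.2 ⟨hcd.2.2, hpre.tail hcd⟩)
    have hD₁ : PreDecomp T bg F₁ P₁ := by
      refine ⟨?_, ?_, ?_⟩
      · have h1 : ∀ a ∈ P₁, Linked T ↑P₁ s a := by
          intro a ha
          rcases Finset.mem_insert.1 ha with rfl | haC
          · exact Linked.refl _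
          · exact (Linked.single hst₁ hsP₁ (Finset.mem_insert_of_mem ht₁C)).trans
              ((hlinkC a haC).mono (Finset.coe_subset.2 (Finset.subset_insert _ _)))
        exact fun a b ha hb => (h1 a ha).symm.trans (h1 b hb)
      · rintro a b ⟨-, t, ht, hat, hbt⟩
        exact ⟨t, ht, hat, hbt⟩
      · intro x a b ha hb hxa hxb
        have hl := hD'.local_linked x (hP₁N ha) (hP₁N hb) hxa hxb
        have key := hl.gateway (P₁ := (↑P₁ : Set ι)) (P₂ := (↑P₂ : Set ι)) (s := s) ?_
          hmeet hsP₁ hsep ha hb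
        · exact key.mono (by rintro t ⟨⟨-, hxt⟩, ht⟩; exact ⟨ht, hxt⟩)
        · rintro t ⟨ht, -⟩; exact hcoverN t ht
    have hD₂ : PreDecomp T bg F₂ P₂ := by
      refine ⟨?_, ?_, ?_⟩
      · have h1 : ∀ a ∈ P₂, Linked T ↑P₂ s a := by
          intro a ha
          obtain ⟨haN, haC⟩ := Finset.mem_sdiff.1 ha
          have hl := (hD.linked hs haN).avoid (C := (↑C : Set ι)) ?_ haC
          · exact hl.mono fun t ht => Finset.mem_sdiff.2 ⟨ht.1, ht.2⟩
          · intro x hx y hy hys hxy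
            exact hCclosed x hx y (Finset.mem_erase.2 ⟨hys, hy⟩) hxy
        exact fun a b ha hb => (h1 a ha).symm.trans (h1 b hb)
      · rintro a b ⟨-, t, ht, hat, hbt⟩
        exact ⟨t, ht, hat, hbt⟩
      · intro x a b ha hb hxa hxb
        have hl := hD'.local_linked x (hP₂N ha) (hP₂N hb) hxa hxb
        have key := hl.gateway (P₁ := (↑P₂ : Set ι)) (P₂ := (↑P₁ : Set ι)) (s := s) ?_
          (fun t ht₂ ht₁ => hmeet t ht₁ ht₂) hsP₂ hsep' ha hb
        · exact key.mono (by rintro t ⟨⟨-, hxt⟩, ht⟩; exact ⟨ht, hxt⟩)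
        · rintro t ⟨ht, -⟩; exact (hcoverN t ht).symm
    have ht₂N : t₂ ∈ N := hN'N ht₂N'
    have ht₂P₁ : t₂ ∉ P₁ := by
      intro h
      rcases Finset.mem_insert.1 h with h | h
      · exact hsN' (h ▸ ht₂N')
      · exact ht₂C h
    have ht₁P₂ : t₁ ∉ P₂ := fun h => (Finset.mem_sdiff.1 h).2 ht₁C
    have hXc : Xᶜ.card ≤ Fintype.card V := Finset.card_le_univ _
    have hμ₁ : P₁.card * (Fintype.card V + 1) + Xᶜ.card < μ := by
      have h1 : P₁.card < N.card :=
        Finset.card_lt_card (Finset.ssubset_iff_subset_ne.2 ⟨hP₁N, fun h => ht₂P₁ (h ▸ ht₂N)⟩)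
      have h2 : (P₁.card + 1) * (Fintype.card V + 1) ≤ N.card * (Fintype.card V + 1) :=
        Nat.mul_le_mul_right _ h1
      nlinarith
    have hμ₂ : P₂.card * (Fintype.card V + 1) + Xᶜ.card < μ := by
      have h1 : P₂.card < N.card :=
        Finset.card_lt_card (Finset.ssubset_iff_subset_ne.2 ⟨hP₂N, fun h => ht₁P₂ (h ▸ ht₁N)⟩)
      have h2 : (P₂.card + 1) * (Fintype.card V + 1) ≤ N.card * (Fintype.card V + 1) :=
        Nat.mul_le_mul_right _ h1
      nlinarith
    have ih₁ := ih F₁ P₁ s X hD₁ hsP₁ hX hμ₁ hp u hu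
    have ih₂ := ih F₂ P₂ s X hD₂ hsP₂ hX hμ₂ hp u hu
    -- multiplicativity
    set W := (P₁.biUnion bg) \ X with hWdef
    have hW₁ : ∀ ⦃a b⦄, F₁.Adj a b → (a ∈ W ∨ a ∈ X) ∧ (b ∈ W ∨ b ∈ X) := by
      rintro a b ⟨-, t, ht, hat, hbt⟩
      have : ∀ c, c ∈ bg t → c ∈ W ∨ c ∈ X := fun c hc => by
        by_cases hcX : c ∈ X
        · exact Or.inr hcX
        · exact Or.inl (Finset.mem_sdiff.2 ⟨Finset.mem_biUnion.2 ⟨t, ht, hc⟩, hcX⟩)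
      exact ⟨this a hat, this b hbt⟩
    have hW₂ : ∀ ⦃a b⦄, F₂.Adj a b → a ∉ W ∧ b ∉ W := by
      rintro a b ⟨-, t, ht, hat, hbt⟩
      have : ∀ c, c ∈ bg t → c ∉ W := fun c hc hcW => by
        obtain ⟨hc₁, hcX⟩ := Finset.mem_sdiff.1 hcW
        obtain ⟨t', ht', hct'⟩ := Finset.mem_biUnion.1 hc₁
        exact hcX (hW c t ht hc t' ht' hct')
      exact ⟨this a hat, this b hbt⟩
    have hWX : Disjoint W X := Finset.disjoint_left.2 fun x hxW hxX => (Finset.mem_sdiff.1 hxW).2 hxX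
    have eG := ccount_sup_mul (G := G) hW₁ hW₂ hWX (fun x => (u x).1)
    have eH := ccount_sup_mul (G := H) hW₁ hW₂ hWX (fun x => (u x).2)
    rw [← hF'eq] at eG eH
    rw [Nat.card_fun, Nat.card_eq_fintype_card, Nat.card_eq_fintype_card] at eG eH
    rw [ih₁, ih₂, hcard, ← eH] at eG
    have hpos : 0 < Fintype.card β ^ Xᶜ.card * Fintype.card β ^ Fintype.card V :=
      Nat.mul_pos (pow_pos (hcard ▸ hApos) _) (pow_pos (hcard ▸ hApos) _)
    rw [mul_assoc, mul_assoc] at eG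
    exact Nat.eq_of_mul_eq_mul_right hpos eG

end Forward

/-- **Game ⇒ hom counts** (Duplicator wins the bijective `k`-pebble game ⇒ equal numbers of
homomorphisms from every finite graph with a tree decomposition of bags of size `≤ k`), for
`k ≥ 1`. The case of empty `G` is handled separately (then `H` is empty too). The game form of
Dvořák 2010, Thm 6, direction (2) ⇒ (1). [cite: Dvorak2010, Thm 6] -/
theorem card_hom_eq_of_ckEquiv {V ι α β : Type*} [Fintype V] [DecidableEq V] [DecidableEq ι]
    [Fintype ι] [Fintype α] [DecidableEq α] [Fintype β] [DecidableEq β] {k : ℕ} (hk : 1 ≤ k)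
    {G : SimpleGraph α} {H : SimpleGraph β} (h : CkEquiv k G H) {F : SimpleGraph V}
    (D : TreeDecomposition F ι) (hD : ∀ t, (D.bag t).card ≤ k) :
    Nat.card (F →g G) = Nat.card (F →g H) := by
  classical
  obtain ⟨𝒮⟩ := h
  have hcard : Fintype.card α = Fintype.card β := CkEquiv.card_eq ⟨𝒮⟩ hk
  obtain ⟨e⟩ := CkEquiv.nonempty_equiv ⟨𝒮⟩ hk
  cases isEmpty_or_nonempty α with
  | inl hα =>
    have hβ : IsEmpty β := by
      rw [← Fintype.card_eq_zero_iff, ← hcard, Fintype.card_eq_zero_iff]; exact hα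
    have hGH : G.map e = H := by
      ext a b
      exact (hβ.false a).elim
    rw [← hGH]
    exact Nat.card_congr
      { toFun := fun f => (Iso.map e G).toHom.comp f
        invFun := fun f => (Iso.map e G).symm.toHom.comp f
        left_inv := fun f => by ext x; simp
        right_inv := fun f => by ext x; simp }
  | inr hα =>
    haveI : Nonempty β := by
      rw [← Fintype.card_pos_iff, ← hcard]; exact Fintype.card_pos
    obtain ⟨s⟩ := D.isTree.1.nonempty
    have key := forward_main 𝒮 hcard D.isTree.2 hD _ F Finset.univ s ∅
      (PreDecomp.of_treeDecomposition D) (Finset.mem_univ s) (Finset.empty_subset _)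
      (Nat.lt_succ_self _) 𝒮.empty_mem (fun _ => (Classical.arbitrary α, Classical.arbitrary β))
      (fun x hx => (Finset.notMem_empty x hx).elim)
    rwa [ccount_empty, ccount_empty] at key

/-- **Game ⇒ hom counts, `Fin` form**: for `k ≥ 1`, graphs `G`, `H` on `Fin n`, `Fin m` with
`G ≡_{C^k} H`, and every `F` on `Fin j` of treewidth `< k`, `hom(F, G) = hom(F, H)`.
[cite: Dvorak2010, Thm 6] -/
theorem homCount_eq_of_ckEquiv {k : ℕ} (hk : 1 ≤ k) {n m : ℕ} {G : SimpleGraph (Fin n)}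
    {H : SimpleGraph (Fin m)} (h : CkEquiv k G H) {j : ℕ} (F : SimpleGraph (Fin j))
    (hF : treewidth F < k) : Nat.card (F →g G) = Nat.card (F →g H) := by
  obtain ⟨n', D, hD⟩ := exists_width_eq_treewidth F
  exact card_hom_eq_of_ckEquiv hk h D fun t => by
    have := D.card_bag_le_width_add_one t; omega

/-! ### G. Labelled test graphs: counts and validity -/

section Tests

variable {γ : Type*}

/-- The **labelled homomorphism count** of an `ℓ`-labelled test graph `F` (vertex type
`Fin ℓ ⊕ R`, the labels being the left summand) into `G` at `v`: homomorphisms `F → G` sending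
label `i` to `v i`. (Dvořák's `Hom(G, H)` for `k`-labelled graphs, with all labels distinct.)
[cite: Dvorak2010, §0 (labelled graphs and Hom)] -/
noncomputable def lcount {ℓ : ℕ} {R : Type*} (F : SimpleGraph (Fin ℓ ⊕ R)) (G : SimpleGraph γ)
    (v : Fin ℓ → γ) : ℕ :=
  Nat.card {g : Fin ℓ ⊕ R → γ // IsHom F G g ∧ ∀ i, g (Sum.inl i) = v i}

/-- An `ℓ`-labelled test graph is **valid at level `k`** if it has a (finitely indexed) tree
decomposition all of whose bags have at most `k` vertices, one bag being exactly the set of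
labels. This is Dvořák's "labelled graph of tree-width at most `k - 1`" (his inductive class,
§2) in tree-decomposition form. [cite: Dvorak2010, §2 (labelled graphs of bounded tree-width)] -/
def LValid (k ℓ : ℕ) {R : Type*} (F : SimpleGraph (Fin ℓ ⊕ R)) : Prop :=
  ∃ (n : ℕ) (D : TreeDecomposition F (Fin n)) (t₀ : Fin n),
    (∀ t, (D.bag t).card ≤ k) ∧ ∀ x, x ∈ D.bag t₀ ↔ ∃ i, x = Sum.inl i

/-- **Reindexing a tree decomposition** along an equivalence of index types. [folklore] -/
def _root_.Literature.Combinatorics.SimpleGraph.TreeDecomposition.reindex {V ι ι' : Type*}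
    {F : SimpleGraph V} (D : TreeDecomposition F ι) (g : ι ≃ ι') : TreeDecomposition F ι' where
  tree := D.tree.map g
  isTree := by
    refine ⟨(Iso.map g D.tree).connected_iff.1 D.isTree.1, ?_⟩
    exact D.isTree.2.comap (Iso.map g D.tree).symm.toHom (Iso.map g D.tree).symm.injective
  bag t := D.bag (g.symm t)
  exists_mem_bag_of_adj u v huv := by
    obtain ⟨t, ha, hb⟩ := D.exists_mem_bag_of_adj huv
    exact ⟨g t, by simpa using ha, by simpa using hb⟩
  connected_induce x := by
    rw [connected_induce_iff]
    obtain ⟨t, ht⟩ := D.exists_mem_bag x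
    refine ⟨⟨g t, by simpa using ht⟩, fun a ha b hb => ?_⟩
    have key := (D.linked x ha hb).map g (T' := D.tree.map g) (S' := {t | x ∈ D.bag (g.symm t)})
      (fun u v _ _ huv => (map_adj_apply (f := g.toEmbedding)).2 huv) (fun u hu => by simpa using hu)
    simpa using key

/-- Validity from a decomposition over any finite index type. [folklore] -/
theorem LValid.mk' {k ℓ : ℕ} {R ι : Type*} [Fintype ι] {F : SimpleGraph (Fin ℓ ⊕ R)}
    (D : TreeDecomposition F ι) (t₀ : ι) (h1 : ∀ t, (D.bag t).card ≤ k)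
    (h2 : ∀ x, x ∈ D.bag t₀ ↔ ∃ i, x = Sum.inl i) : LValid k ℓ F := by
  refine ⟨Fintype.card ι, D.reindex (Fintype.equivFin ι), Fintype.equivFin ι t₀, fun t => h1 _, ?_⟩
  intro x
  simp only [TreeDecomposition.reindex, Equiv.symm_apply_apply]
  exact h2 x

/-- In a valid test the number of labels is at most `k`. [folklore] -/
theorem LValid.le {k ℓ : ℕ} {R : Type*} {F : SimpleGraph (Fin ℓ ⊕ R)} (h : LValid k ℓ F) :
    ℓ ≤ k := by
  obtain ⟨n, D, t₀, h1, h2⟩ := h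
  have : ((Finset.univ : Finset (Fin ℓ)).map
      ⟨(Sum.inl : Fin ℓ → Fin ℓ ⊕ R), Sum.inl_injective⟩).card ≤ (D.bag t₀).card := by
    apply Finset.card_le_card
    intro x hx
    rw [Finset.mem_map] at hx
    obtain ⟨i, -, rfl⟩ := hx
    exact (h2 _).2 ⟨i, rfl⟩
  simpa using this.trans (h1 t₀)

/-! #### Transport along label-preserving equivalences -/

/-- `lcount` is invariant under pushing forward along an equivalence fixing the labels.
[folklore] -/
theorem lcount_map_equiv {ℓ : ℕ} {R R' : Type*} (F : SimpleGraph (Fin ℓ ⊕ R))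
    (e : Fin ℓ ⊕ R ≃ Fin ℓ ⊕ R') (he : ∀ i, e (Sum.inl i) = Sum.inl i) (G : SimpleGraph γ)
    (v : Fin ℓ → γ) : lcount (F.map e) G v = lcount F G v := by
  have hφ : ∀ ⦃a b⦄, F.Adj a b → e a ≠ e b := fun a b hab h => hab.ne (e.injective h)
  refine Nat.card_congr
    { toFun := fun g => ⟨g.1 ∘ e, (isHom_map_iff e hφ).1 g.2.1, fun i => by
        simp only [Function.comp_apply, he]; exact g.2.2 i⟩
      invFun := fun g => ⟨g.1 ∘ e.symm, (isHom_map_iff e hφ).2 (by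
          simpa only [Function.comp_assoc, Equiv.symm_comp_self, Function.comp_id] using g.2.1),
        fun i => by
          have : e.symm (Sum.inl i) = Sum.inl i := by rw [Equiv.symm_apply_eq]; exact (he i).symm
          simp only [Function.comp_apply, this]; exact g.2.2 i⟩
      left_inv := fun g => by ext x; simp
      right_inv := fun g => by ext x; simp }

/-- Validity is invariant under pushing forward along an equivalence fixing the labels.
[folklore] -/
theorem LValid.map_equiv {k ℓ : ℕ} {R R' : Type*} {F : SimpleGraph (Fin ℓ ⊕ R)}
    (h : LValid k ℓ F) (e : Fin ℓ ⊕ R ≃ Fin ℓ ⊕ R') (he : ∀ i, e (Sum.inl i) = Sum.inl i) :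
    LValid k ℓ (F.map e) := by
  obtain ⟨n, D, t₀, h1, h2⟩ := h
  refine ⟨n, D.transport e (Equiv.refl _), t₀, fun t => by simpa using h1 t, fun x => ?_⟩
  rw [TreeDecomposition.mem_bag_transport, Equiv.refl_symm, Equiv.refl_apply, h2]
  constructor
  · rintro ⟨i, hi⟩
    exact ⟨i, by rw [← he i, ← hi, Equiv.apply_symm_apply]⟩
  · rintro ⟨i, rfl⟩
    exact ⟨i, by rw [Equiv.symm_apply_eq, he]⟩

/-! #### Gluing along the labels (Dvořák's product) -/

/-- The embedding of the first factor into the glued vertex type. [folklore] -/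
def gl₁ (ℓ : ℕ) (R₁ R₂ : Type*) : Fin ℓ ⊕ R₁ ↪ Fin ℓ ⊕ (R₁ ⊕ R₂) :=
  ⟨Sum.map id Sum.inl, Sum.map_injective.2 ⟨Function.injective_id, Sum.inl_injective⟩⟩

/-- The embedding of the second factor into the glued vertex type. [folklore] -/
def gl₂ (ℓ : ℕ) (R₁ R₂ : Type*) : Fin ℓ ⊕ R₂ ↪ Fin ℓ ⊕ (R₁ ⊕ R₂) :=
  ⟨Sum.map id Sum.inr, Sum.map_injective.2 ⟨Function.injective_id, Sum.inr_injective⟩⟩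

/-- [folklore] -/
@[simp] theorem gl₁_inl {ℓ : ℕ} {R₁ R₂ : Type*} (i : Fin ℓ) : gl₁ ℓ R₁ R₂ (Sum.inl i) = Sum.inl i :=
  rfl

/-- [folklore] -/
@[simp] theorem gl₁_inr {ℓ : ℕ} {R₁ R₂ : Type*} (r : R₁) :
    gl₁ ℓ R₁ R₂ (Sum.inr r) = Sum.inr (Sum.inl r) := rfl

/-- [folklore] -/
@[simp] theorem gl₂_inl {ℓ : ℕ} {R₁ R₂ : Type*} (i : Fin ℓ) : gl₂ ℓ R₁ R₂ (Sum.inl i) = Sum.inl i :=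
  rfl

/-- [folklore] -/
@[simp] theorem gl₂_inr {ℓ : ℕ} {R₁ R₂ : Type*} (r : R₂) :
    gl₂ ℓ R₁ R₂ (Sum.inr r) = Sum.inr (Sum.inr r) := rfl

/-- **Gluing two `ℓ`-labelled test graphs along their labels** (Dvořák's product `G₁G₂`):
disjoint union with the labels identified. [cite: Dvorak2010, §0 (product of labelled graphs)] -/
def glue {ℓ : ℕ} {R₁ R₂ : Type*} (F₁ : SimpleGraph (Fin ℓ ⊕ R₁)) (F₂ : SimpleGraph (Fin ℓ ⊕ R₂)) :
    SimpleGraph (Fin ℓ ⊕ (R₁ ⊕ R₂)) :=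
  F₁.map (gl₁ ℓ R₁ R₂) ⊔ F₂.map (gl₂ ℓ R₁ R₂)

/-- **`Hom(G₁G₂, H) = Hom(G₁, H) · Hom(G₂, H)`** for labelled graphs.
[cite: Dvorak2010, §0 (Hom(G₁G₂, H) = Hom(G₁, H)Hom(G₂, H))] -/
theorem lcount_glue {ℓ : ℕ} {R₁ R₂ : Type*} (F₁ : SimpleGraph (Fin ℓ ⊕ R₁))
    (F₂ : SimpleGraph (Fin ℓ ⊕ R₂)) (G : SimpleGraph γ) (v : Fin ℓ → γ) :
    lcount (glue F₁ F₂) G v = lcount F₁ G v * lcount F₂ G v := by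
  unfold lcount
  rw [← Nat.card_prod]
  have hφ₁ : ∀ ⦃a b⦄, F₁.Adj a b → gl₁ ℓ R₁ R₂ a ≠ gl₁ ℓ R₁ R₂ b :=
    fun a b hab h => hab.ne ((gl₁ ℓ R₁ R₂).injective h)
  have hφ₂ : ∀ ⦃a b⦄, F₂.Adj a b → gl₂ ℓ R₁ R₂ a ≠ gl₂ ℓ R₁ R₂ b :=
    fun a b hab h => hab.ne ((gl₂ ℓ R₁ R₂).injective h)
  refine Nat.card_congr
    { toFun := fun g =>
        (⟨g.1 ∘ gl₁ ℓ R₁ R₂, (isHom_map_iff _ hφ₁).1 (isHom_sup_iff.1 g.2.1).1, fun i => g.2.2 i⟩,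
         ⟨g.1 ∘ gl₂ ℓ R₁ R₂, (isHom_map_iff _ hφ₂).1 (isHom_sup_iff.1 g.2.1).2, fun i => g.2.2 i⟩)
      invFun := fun gg => ⟨Sum.elim v (Sum.elim (gg.1.1 ∘ Sum.inr) (gg.2.1 ∘ Sum.inr)), ?_, fun i => rfl⟩
      left_inv := ?_
      right_inv := ?_ }
  · rw [glue, isHom_sup_iff, isHom_map_iff _ hφ₁, isHom_map_iff _ hφ₂]
    have e1 : Sum.elim v (Sum.elim (gg.1.1 ∘ Sum.inr) (gg.2.1 ∘ Sum.inr)) ∘ gl₁ ℓ R₁ R₂ = gg.1.1 := by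
      funext x; rcases x with i | r
      · simpa using (gg.1.2.2 i).symm
      · simp
    have e2 : Sum.elim v (Sum.elim (gg.1.1 ∘ Sum.inr) (gg.2.1 ∘ Sum.inr)) ∘ gl₂ ℓ R₁ R₂ = gg.2.1 := by
      funext x; rcases x with i | r
      · simpa using (gg.2.2.2 i).symm
      · simp
    rw [e1, e2]
    exact ⟨gg.1.2.1, gg.2.2.1⟩
  · rintro ⟨g, hg, hgv⟩
    apply Subtype.ext
    funext x
    rcases x with i | r | r
    · simpa using (hgv i).symm
    · simp
    · simp
  · rintro ⟨⟨g₁, hg₁, hg₁v⟩, ⟨g₂, hg₂, hg₂v⟩⟩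
    simp only [Prod.mk.injEq]
    constructor
    · apply Subtype.ext; funext x; rcases x with i | r
      · simpa using (hg₁v i).symm
      · simp
    · apply Subtype.ext; funext x; rcases x with i | r
      · simpa using (hg₂v i).symm
      · simp

/-- **Gluing preserves validity** (join the two decompositions by an edge between their label
bags). [cite: Dvorak2010, §2 (G₁G₂ has tree-width at most k)] -/
theorem lvalid_glue {k ℓ : ℕ} {R₁ R₂ : Type*} {F₁ : SimpleGraph (Fin ℓ ⊕ R₁)}
    {F₂ : SimpleGraph (Fin ℓ ⊕ R₂)} (h₁ : LValid k ℓ F₁) (h₂ : LValid k ℓ F₂) :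
    LValid k ℓ (glue F₁ F₂) := by
  classical
  obtain ⟨n₁, D₁, t₁, hD₁, ht₁⟩ := h₁
  obtain ⟨n₂, D₂, t₂, hD₂, ht₂⟩ := h₂
  have hyp : Join.Hyp (glue F₁ F₂) D₁.tree D₂.tree (fun t => (D₁.bag t).map (gl₁ ℓ R₁ R₂))
      (fun t => (D₂.bag t).map (gl₂ ℓ R₁ R₂)) t₁ t₂ := by
    refine ⟨D₁.isTree, D₂.isTree, ?_, ?_, ?_, ?_, ?_⟩
    · rintro u v (huv | huv)
      · obtain ⟨-, a, b, hab, rfl, rfl⟩ := huv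
        obtain ⟨t, ha, hb⟩ := D₁.exists_mem_bag_of_adj hab
        exact Or.inl ⟨t, (Finset.mem_map' _).2 ha, (Finset.mem_map' _).2 hb⟩
      · obtain ⟨-, a, b, hab, rfl, rfl⟩ := huv
        obtain ⟨t, ha, hb⟩ := D₂.exists_mem_bag_of_adj hab
        exact Or.inr ⟨t, (Finset.mem_map' _).2 ha, (Finset.mem_map' _).2 hb⟩
    · rintro (i | r | r)
      · exact Or.inl ⟨t₁, (Finset.mem_map' (gl₁ ℓ R₁ R₂) (a := Sum.inl i)).2 ((ht₁ _).2 ⟨i, rfl⟩)⟩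
      · obtain ⟨t, ht⟩ := D₁.exists_mem_bag (Sum.inr r)
        exact Or.inl ⟨t, (Finset.mem_map' (gl₁ ℓ R₁ R₂) (a := Sum.inr r)).2 ht⟩
      · obtain ⟨t, ht⟩ := D₂.exists_mem_bag (Sum.inr r)
        exact Or.inr ⟨t, (Finset.mem_map' (gl₂ ℓ R₁ R₂) (a := Sum.inr r)).2 ht⟩
    · intro x a b ha hb
      rw [Finset.mem_map] at ha hb
      obtain ⟨y, hya, rfl⟩ := ha
      obtain ⟨y', hyb, hyy'⟩ := hb
      rw [(gl₁ ℓ R₁ R₂).injective hyy'] at hyb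
      exact (D₁.linked y hya hyb).mono fun t ht => (Finset.mem_map' _).2 ht
    · intro x a b ha hb
      rw [Finset.mem_map] at ha hb
      obtain ⟨y, hya, rfl⟩ := ha
      obtain ⟨y', hyb, hyy'⟩ := hb
      rw [(gl₂ ℓ R₁ R₂).injective hyy'] at hyb
      exact (D₂.linked y hya hyb).mono fun t ht => (Finset.mem_map' _).2 ht
    · intro x a b ha hb
      rw [Finset.mem_map] at ha hb
      obtain ⟨y, -, rfl⟩ := ha
      obtain ⟨y', -, hyy'⟩ := hb
      rcases y with i | r
      · refine ⟨(Finset.mem_map' (gl₁ ℓ R₁ R₂) (a := Sum.inl i)).2 ((ht₁ _).2 ⟨i, rfl⟩), ?_⟩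
        have : gl₂ ℓ R₁ R₂ (Sum.inl i) = gl₁ ℓ R₁ R₂ (Sum.inl i) := rfl
        rw [← this]
        exact (Finset.mem_map' _).2 ((ht₂ _).2 ⟨i, rfl⟩)
      · rcases y' with i' | r' <;> simp [gl₁, gl₂] at hyy'
  refine LValid.mk' (Join.treeDecomposition hyp) (Sum.inl t₁) ?_ ?_
  · rintro (t | t) <;> simp [hD₁, hD₂]
  · intro x
    simp only [Join.treeDecomposition_bag, Sum.elim_inl, Finset.mem_map]
    constructor
    · rintro ⟨y, hy, rfl⟩
      obtain ⟨i, rfl⟩ := (ht₁ y).1 hy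
      exact ⟨i, rfl⟩
    · rintro ⟨i, rfl⟩
      exact ⟨Sum.inl i, (ht₁ _).2 ⟨i, rfl⟩, rfl⟩

/-! #### Pushing labels forward along a map (re-indexing, identification of labels) -/

/-- **Pushing an `ℓ'`-labelled test forward along `σ : Fin ℓ' → Fin L`**: label `j` becomes label
`σ j` (labels with the same image are identified; unused new labels are isolated vertices).
[cite: Dvorak2010, §0 (labels on not necessarily distinct vertices)] -/
def push {ℓ' L : ℕ} {R : Type*} (σ : Fin ℓ' → Fin L) (F : SimpleGraph (Fin ℓ' ⊕ R)) :
    SimpleGraph (Fin L ⊕ R) :=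
  F.map (Sum.map σ id)

/-- If `σ` identifies two adjacent labels, the labelled count at `w ∘ σ` vanishes (no loops).
[folklore] -/
theorem lcount_eq_zero_of_collision {ℓ' L : ℕ} {R : Type*} (σ : Fin ℓ' → Fin L)
    (F : SimpleGraph (Fin ℓ' ⊕ R)) (G : SimpleGraph γ) (w : Fin L → γ) {i j : Fin ℓ'}
    (hij : F.Adj (Sum.inl i) (Sum.inl j)) (hσ : σ i = σ j) : lcount F G (w ∘ σ) = 0 := by
  unfold lcount
  rw [Nat.card_eq_zero]
  refine Or.inl ⟨fun g => ?_⟩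
  have h := g.2.1 hij
  rw [g.2.2 i, g.2.2 j, Function.comp_apply, Function.comp_apply, hσ] at h
  exact G.irrefl h

/-- **Counting through a push-forward**: if `σ` identifies no two adjacent labels, then
`lcount (push σ F) G w = lcount F G (w ∘ σ)`. [folklore] -/
theorem lcount_push {ℓ' L : ℕ} {R : Type*} (σ : Fin ℓ' → Fin L) (F : SimpleGraph (Fin ℓ' ⊕ R))
    (hσ : ∀ i j, F.Adj (Sum.inl i) (Sum.inl j) → σ i ≠ σ j) (G : SimpleGraph γ) (w : Fin L → γ) :
    lcount (push σ F) G w = lcount F G (w ∘ σ) := by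
  have hφ : ∀ ⦃a b⦄, F.Adj a b → Sum.map σ id a ≠ Sum.map σ id b := by
    rintro (i | r) (j | r') hab h
    · exact hσ i j hab (Sum.inl_injective h)
    · exact Sum.inl_ne_inr h
    · exact Sum.inr_ne_inl h
    · exact hab.ne (by simpa using h)
  refine Nat.card_congr
    { toFun := fun g => ⟨g.1 ∘ Sum.map σ id, (isHom_map_iff _ hφ).1 g.2.1, fun i => by
        simpa using g.2.2 (σ i)⟩
      invFun := fun g => ⟨Sum.elim w (g.1 ∘ Sum.inr), (isHom_map_iff _ hφ).2 ?_, fun i => rfl⟩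
      left_inv := ?_
      right_inv := ?_ }
  · have : Sum.elim w (g.1 ∘ Sum.inr) ∘ Sum.map σ id = g.1 := by
      funext x; rcases x with i | r
      · simpa using (g.2.2 i).symm
      · simp
    rw [this]; exact g.2.1
  · rintro ⟨g, hg, hgw⟩
    apply Subtype.ext; funext x; rcases x with i | r
    · simpa using (hgw i).symm
    · simp
  · rintro ⟨g, hg, hgw⟩
    apply Subtype.ext; funext x; rcases x with i | r
    · simpa using (hgw i).symm
    · simp

/-- **Pushing preserves validity** as long as the new number of labels is at most `k` (image
decomposition joined to a pendant bag holding exactly the new labels). [folklore] -/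
theorem lvalid_push {k ℓ' L : ℕ} {R : Type*} [DecidableEq R] {F : SimpleGraph (Fin ℓ' ⊕ R)}
    (h : LValid k ℓ' F) (σ : Fin ℓ' → Fin L) (hL : L ≤ k) : LValid k L (push σ F) := by
  classical
  obtain ⟨n, D, t₀, hD, ht₀⟩ := h
  set φ : Fin ℓ' ⊕ R → Fin L ⊕ R := Sum.map σ id with hφ
  set B : Finset (Fin L ⊕ R) := (Finset.univ : Finset (Fin L)).map ⟨Sum.inl, Sum.inl_injective⟩
    with hB
  have hBmem : ∀ x, x ∈ B ↔ ∃ i, x = Sum.inl i := fun x => by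
    simp only [hB, Finset.mem_map, Finset.mem_univ, true_and, Function.Embedding.coeFn_mk]
    exact ⟨fun ⟨i, hi⟩ => ⟨i, hi.symm⟩, fun ⟨i, hi⟩ => ⟨i, hi.symm⟩⟩
  have hyp : Join.Hyp (push σ F) D.tree (⊥ : SimpleGraph Unit) (fun t => (D.bag t).image φ)
      (fun _ => B) t₀ () := by
    refine ⟨D.isTree, IsTree.of_subsingleton, ?_, ?_, ?_, ?_, ?_⟩
    · rintro u v ⟨-, a, b, hab, rfl, rfl⟩
      obtain ⟨t, ha, hb⟩ := D.exists_mem_bag_of_adj hab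
      exact Or.inl ⟨t, Finset.mem_image_of_mem _ ha, Finset.mem_image_of_mem _ hb⟩
    · rintro (i | r)
      · exact Or.inr ⟨(), (hBmem _).2 ⟨i, rfl⟩⟩
      · obtain ⟨t, ht⟩ := D.exists_mem_bag (Sum.inr r)
        exact Or.inl ⟨t, by simpa [hφ] using Finset.mem_image_of_mem φ ht⟩
    · intro x a b ha hb
      rw [Finset.mem_image] at ha hb
      obtain ⟨y, hya, rfl⟩ := ha
      obtain ⟨y', hyb, hyy'⟩ := hb
      by_cases hy : y = y'
      · subst hy
        exact (D.linked y hya hyb).mono fun t ht => Finset.mem_image_of_mem _ ht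
      · -- two distinct preimages: both are labels, hence both lie in the label bag `t₀`
        have hlab : (∃ i, y = Sum.inl i) ∧ ∃ i, y' = Sum.inl i := by
          rcases y with i | r <;> rcases y' with i' | r'
          · exact ⟨⟨i, rfl⟩, ⟨i', rfl⟩⟩
          · simp [hφ] at hyy'
          · simp [hφ] at hyy'
          · simp only [hφ, Sum.map_inr, id_eq, Sum.inr.injEq] at hyy'
            exact (hy (by rw [hyy'])).elim
        have hy₀ : y ∈ D.bag t₀ := (ht₀ y).2 hlab.1
        have hy'₀ : y' ∈ D.bag t₀ := (ht₀ y').2 hlab.2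
        refine ((D.linked y hya hy₀).mono fun t ht => Finset.mem_image_of_mem _ ht).trans
          ((D.linked y' hy'₀ hyb).mono fun t ht => ?_)
        rw [← hyy']
        exact Finset.mem_image_of_mem _ ht
    · intro x a b _ _
      obtain rfl : a = b := Subsingleton.elim a b
      exact Linked.refl _
    · intro x a b ha hb
      refine ⟨?_, hb⟩
      obtain ⟨i, rfl⟩ := (hBmem x).1 hb
      rw [Finset.mem_image] at ha
      obtain ⟨y, -, hy⟩ := ha
      rcases y with j | r
      · simp only [hφ, Sum.map_inl, Sum.inl.injEq] at hy
        subst hy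
        exact Finset.mem_image.2 ⟨Sum.inl j, (ht₀ _).2 ⟨j, rfl⟩, rfl⟩
      · simp [hφ] at hy
  refine LValid.mk' (Join.treeDecomposition hyp) (Sum.inr ()) ?_ ?_
  · rintro (t | t)
    · exact (Finset.card_image_le).trans (hD t)
    · simpa [hB] using hL
  · intro x
    simpa using hBmem x

/-! #### Removing the last label (Dvořák's label removal) -/

/-- The vertex bijection moving the last label `ℓ` to the unlabelled side. [folklore] -/
def unlabelEquiv (ℓ : ℕ) (R : Type*) : Fin (ℓ + 1) ⊕ R ≃ Fin ℓ ⊕ (Fin 1 ⊕ R) :=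
  (Equiv.sumCongr finSumFinEquiv.symm (Equiv.refl R)).trans (Equiv.sumAssoc _ _ _)

/-- [folklore] -/
@[simp] theorem unlabelEquiv_castSucc {ℓ : ℕ} {R : Type*} (i : Fin ℓ) :
    unlabelEquiv ℓ R (Sum.inl i.castSucc) = Sum.inl i := by
  simp [unlabelEquiv]

/-- [folklore] -/
@[simp] theorem unlabelEquiv_last {ℓ : ℕ} {R : Type*} :
    unlabelEquiv ℓ R (Sum.inl (Fin.last ℓ)) = Sum.inr (Sum.inl 0) := by
  simp [unlabelEquiv]

/-- [folklore] -/
@[simp] theorem unlabelEquiv_inr {ℓ : ℕ} {R : Type*} (r : R) :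
    unlabelEquiv ℓ R (Sum.inr r) = Sum.inr (Sum.inr r) := by
  simp [unlabelEquiv]

/-- **Removing the last label** of an `(ℓ+1)`-labelled test graph.
[cite: Dvorak2010, §2 (removing labels)] -/
def unlabel {ℓ : ℕ} {R : Type*} (F : SimpleGraph (Fin (ℓ + 1) ⊕ R)) :
    SimpleGraph (Fin ℓ ⊕ (Fin 1 ⊕ R)) :=
  F.map (unlabelEquiv ℓ R)

/-- **Unlabelling sums over the removed label**:
`lcount (unlabel F) G v = ∑ₐ lcount F G (v, a)`. [folklore] -/
theorem lcount_unlabel [Fintype γ] {ℓ : ℕ} {R : Type*} [Finite R] (F : SimpleGraph (Fin (ℓ + 1) ⊕ R))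
    (G : SimpleGraph γ) (v : Fin ℓ → γ) :
    lcount (unlabel F) G v = ∑ a, lcount F G (Fin.snoc v a : Fin (ℓ + 1) → γ) := by
  classical
  set e := unlabelEquiv ℓ R with he
  have hφ : ∀ ⦃a b⦄, F.Adj a b → e a ≠ e b := fun a b hab h => hab.ne (e.injective h)
  -- step 1: transport to functions on the original vertex type
  have step1 : lcount (unlabel F) G v =
      Nat.card {g : Fin (ℓ + 1) ⊕ R → γ // IsHom F G g ∧ ∀ i : Fin ℓ, g (Sum.inl i.castSucc) = v i} := by
    refine Nat.card_congr
      { toFun := fun g => ⟨g.1 ∘ e, (isHom_map_iff e hφ).1 g.2.1, fun i => by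
          simp only [Function.comp_apply, he, unlabelEquiv_castSucc]; exact g.2.2 i⟩
        invFun := fun g => ⟨g.1 ∘ e.symm, (isHom_map_iff e hφ).2 (by
            simpa only [Function.comp_assoc, Equiv.symm_comp_self, Function.comp_id] using g.2.1),
          fun i => by
            have : e.symm (Sum.inl i) = Sum.inl i.castSucc := by
              rw [Equiv.symm_apply_eq, he, unlabelEquiv_castSucc]
            simp only [Function.comp_apply, this]; exact g.2.2 i⟩
        left_inv := fun g => by ext x; simp
        right_inv := fun g => by ext x; simp }
  rw [step1]
  unfold lcount
  rw [← Nat.card_sigma]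
  refine Nat.card_congr ((Equiv.sigmaFiberEquiv fun g : {g : Fin (ℓ + 1) ⊕ R → γ //
      IsHom F G g ∧ ∀ i : Fin ℓ, g (Sum.inl i.castSucc) = v i} => g.1 (Sum.inl (Fin.last ℓ))).symm.trans
    (Equiv.sigmaCongrRight fun a => ?_))
  exact
    { toFun := fun g => ⟨g.1.1, g.1.2.1, fun i => by
        induction i using Fin.lastCases with
        | last => rw [Fin.snoc_last]; exact g.2
        | cast i => rw [Fin.snoc_castSucc]; exact g.1.2.2 i⟩
      invFun := fun g => ⟨⟨g.1, g.2.1, fun i => by rw [g.2.2, Fin.snoc_castSucc]⟩,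
        by simp only [g.2.2, Fin.snoc_last]⟩
      left_inv := fun g => rfl
      right_inv := fun g => rfl }

/-- **Unlabelling preserves validity** (transport the decomposition and hang a pendant bag
holding exactly the remaining labels off the old label bag).
[cite: Dvorak2010, §2 (removing labels keeps tree-width at most k)] -/
theorem lvalid_unlabel {k ℓ : ℕ} {R : Type*} {F : SimpleGraph (Fin (ℓ + 1) ⊕ R)}
    (h : LValid k (ℓ + 1) F) : LValid k ℓ (unlabel F) := by
  classical
  have hℓ : ℓ + 1 ≤ k := h.le
  obtain ⟨n, D, t₀, hD, ht₀⟩ := h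
  set D' := D.transport (unlabelEquiv ℓ R) (Equiv.refl (Fin n)) with hD'
  set B : Finset (Fin ℓ ⊕ (Fin 1 ⊕ R)) :=
    (Finset.univ : Finset (Fin ℓ)).map ⟨Sum.inl, Sum.inl_injective⟩ with hB
  have hBmem : ∀ x, x ∈ B ↔ ∃ i, x = Sum.inl i := fun x => by
    simp only [hB, Finset.mem_map, Finset.mem_univ, true_and, Function.Embedding.coeFn_mk]
    exact ⟨fun ⟨i, hi⟩ => ⟨i, hi.symm⟩, fun ⟨i, hi⟩ => ⟨i, hi.symm⟩⟩
  have hyp : Join.Hyp (unlabel F) D'.tree (⊥ : SimpleGraph Unit) D'.bag (fun _ => B) t₀ () := by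
    refine ⟨D'.isTree, IsTree.of_subsingleton, ?_, ?_, ?_, ?_, ?_⟩
    · intro u v huv
      obtain ⟨t, hu, hv⟩ := D'.exists_mem_bag_of_adj huv
      exact Or.inl ⟨t, hu, hv⟩
    · intro x
      obtain ⟨t, ht⟩ := D'.exists_mem_bag x
      exact Or.inl ⟨t, ht⟩
    · intro x a b ha hb
      exact D'.linked x ha hb
    · intro x a b _ _
      obtain rfl : a = b := Subsingleton.elim a b
      exact Linked.refl _
    · intro x a b _ hb
      refine ⟨?_, hb⟩
      obtain ⟨i, rfl⟩ := (hBmem x).1 hb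
      rw [hD', TreeDecomposition.mem_bag_transport, Equiv.refl_symm, Equiv.refl_apply, ht₀]
      exact ⟨i.castSucc, by rw [Equiv.symm_apply_eq, unlabelEquiv_castSucc]⟩
  refine LValid.mk' (Join.treeDecomposition hyp) (Sum.inr ()) ?_ ?_
  · rintro (t | t)
    · simp only [Join.treeDecomposition_bag, Sum.elim_inl, hD', TreeDecomposition.card_bag_transport]
      exact hD _
    · simp only [Join.treeDecomposition_bag, Sum.elim_inr, hB, Finset.card_map, Finset.card_univ,
        Fintype.card_fin]
      omega
  · intro x
    simpa using hBmem x

/-! #### The basic tests: no edges, one edge -/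

/-- On `Fin ℓ ⊕ Fin 0` every vertex is a label. [folklore] -/
theorem exists_eq_inl_of_fin_zero {ℓ : ℕ} (x : Fin ℓ ⊕ Fin 0) : ∃ i, x = Sum.inl i := by
  rcases x with i | r
  · exact ⟨i, rfl⟩
  · exact r.elim0

/-- A test all of whose vertices are labels, with at most `k` of them, is valid (one bag).
[cite: Dvorak2010, §2 (base case: every vertex has a label)] -/
theorem LValid.of_fin_zero {k ℓ : ℕ} (F : SimpleGraph (Fin ℓ ⊕ Fin 0)) (hℓ : ℓ ≤ k) : LValid k ℓ F := by
  refine LValid.mk' (TreeDecomposition.trivial F) 0 (fun t => ?_) (fun x => ?_)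
  · simp only [TreeDecomposition.trivial, Finset.card_univ, Fintype.card_sum, Fintype.card_fin]
    omega
  · simp only [TreeDecomposition.trivial, Finset.mem_univ, true_iff]
    exact exists_eq_inl_of_fin_zero x

/-- With every vertex a label, the labelled count is `1` or `0` according as `v` respects the
edges. [folklore] -/
theorem lcount_of_fin_zero {ℓ : ℕ} (F : SimpleGraph (Fin ℓ ⊕ Fin 0)) (G : SimpleGraph γ) (v : Fin ℓ → γ)
    [Decidable (∀ i j, F.Adj (Sum.inl i) (Sum.inl j) → G.Adj (v i) (v j))] :
    lcount F G v = if ∀ i j, F.Adj (Sum.inl i) (Sum.inl j) → G.Adj (v i) (v j) then 1 else 0 := by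
  unfold lcount
  have hfun : ∀ g : Fin ℓ ⊕ Fin 0 → γ, (∀ i, g (Sum.inl i) = v i) → g = Sum.elim v Fin.elim0 := by
    intro g hg; funext x; rcases x with i | r
    · exact hg i
    · exact r.elim0
  split_ifs with hv
  · rw [Nat.card_eq_one_iff_unique]
    refine ⟨⟨fun a b => Subtype.ext ((hfun a.1 a.2.2).trans (hfun b.1 b.2.2).symm)⟩,
      ⟨⟨Sum.elim v Fin.elim0, ?_, fun i => rfl⟩⟩⟩
    rintro (i | r) (j | r') hab
    · exact hv i j hab
    · exact r'.elim0
    · exact r.elim0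
    · exact r.elim0
  · rw [Nat.card_eq_zero]
    refine Or.inl ⟨fun g => hv fun i j hij => ?_⟩
    rw [← g.2.2 i, ← g.2.2 j]; exact g.2.1 hij

/-- The edgeless test has labelled count `1`. [folklore] -/
theorem lcount_bot_fin_zero {ℓ : ℕ} (G : SimpleGraph γ) (v : Fin ℓ → γ) :
    lcount (⊥ : SimpleGraph (Fin ℓ ⊕ Fin 0)) G v = 1 := by
  classical
  rw [lcount_of_fin_zero, if_pos]
  intro i j h; exact h.elim

/-- The **edge test**: two labels joined by an edge. [cite: Dvorak2010, Lemma 5 (G = K₂)] -/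
def edgeTest : SimpleGraph (Fin 2 ⊕ Fin 0) := edge (Sum.inl 0) (Sum.inl 1)

/-- The edge test counts adjacency of the two images. [cite: Dvorak2010, Lemma 5 (E(xᵢ, xⱼ))] -/
theorem lcount_edgeTest (G : SimpleGraph γ) (v : Fin 2 → γ) [Decidable (G.Adj (v 0) (v 1))] :
    lcount edgeTest G v = if G.Adj (v 0) (v 1) then 1 else 0 := by
  classical
  rw [lcount_of_fin_zero]
  apply if_congr _ rfl rfl
  constructor
  · intro h
    exact h 0 1 (by simp [edgeTest, edge_adj])
  · intro h i j hij
    simp only [edgeTest, edge_adj, Sum.inl.injEq, ne_eq] at hij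
    rcases hij.1 with ⟨rfl, rfl⟩ | ⟨rfl, rfl⟩
    · exact h
    · exact h.symm

/-! #### Glued products of lists of tests -/

/-- The type of valid `ℓ`-labelled tests at level `k` on vertex types `Fin ℓ ⊕ Fin r`.
[folklore] -/
def Test (k ℓ : ℕ) : Type := Σ r : ℕ, {F : SimpleGraph (Fin ℓ ⊕ Fin r) // LValid k ℓ F}

/-- **Products of tests exist**: for every list of valid `ℓ`-labelled tests (`ℓ ≤ k`) there is a
valid test whose labelled counts are the products of theirs, uniformly in the target.
[cite: Dvorak2010, §2 (closure under products)] -/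
theorem exists_lcount_eq_prod {k ℓ : ℕ} (hℓ : ℓ ≤ k) (L : List (Test k ℓ)) :
    ∃ (r : ℕ) (P : SimpleGraph (Fin ℓ ⊕ Fin r)), LValid k ℓ P ∧
      ∀ (γ : Type) (G : SimpleGraph γ) (v : Fin ℓ → γ),
        lcount P G v = (L.map fun t => lcount t.2.1 G v).prod := by
  induction L with
  | nil => exact ⟨0, ⊥, LValid.of_fin_zero ⊥ hℓ, fun γ G v => by simp [lcount_bot_fin_zero]⟩
  | cons t L ih =>
    obtain ⟨r, P, hP, hprod⟩ := ih
    let e : Fin ℓ ⊕ (Fin t.1 ⊕ Fin r) ≃ Fin ℓ ⊕ Fin (t.1 + r) :=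
      Equiv.sumCongr (Equiv.refl _) finSumFinEquiv
    refine ⟨t.1 + r, (glue t.2.1 P).map e, (lvalid_glue t.2.2 hP).map_equiv e (fun i => rfl),
      fun γ G v => ?_⟩
    rw [lcount_map_equiv _ e (fun i => rfl), lcount_glue, hprod γ G v, List.map_cons, List.prod_cons]

end Tests

/-! ### H. Interpolation: moments determine the value distribution (Dvořák's Observation 4) -/

section Moments

open MvPolynomial in
/-- **Moments determine the distribution.** If two finite families of vectors `v x, w y : ι → ℕ`
have the same mixed moments `∑ₓ ∏ᵢ (v x i)^{mᵢ}` for every finitely supported exponent `m`,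
then every vector occurs equally often in both families. Proof: a Lagrange-type product
polynomial in finitely many separating coordinates is `1` at `τ` and `0` at every other
realised vector (Dvořák 2010, Observation 4: "let `p(x) = ∑ aᵢ xⁱ` be a polynomial such that
`p(x) = 0` for `x ∈ X₀` and `p(x) = 1` for `x ∈ X₁`"). [cite: Dvorak2010, Observation 4] -/
theorem card_fiber_eq_of_moments {X Y ι : Type*} [Fintype X] [Fintype Y] (v : X → ι → ℕ)
    (w : Y → ι → ℕ)
    (h : ∀ m : ι →₀ ℕ, ∑ x, m.prod (fun i n => v x i ^ n) = ∑ y, m.prod (fun i n => w y i ^ n))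
    (τ : ι → ℕ) : Nat.card {x // v x = τ} = Nat.card {y // w y = τ} := by
  classical
  set Rset : Finset (ι → ℕ) := Finset.univ.image v ∪ Finset.univ.image w with hRset
  have hvR : ∀ x, v x ∈ Rset := fun x =>
    Finset.mem_union_left _ (Finset.mem_image.2 ⟨x, Finset.mem_univ _, rfl⟩)
  have hwR : ∀ y, w y ∈ Rset := fun y =>
    Finset.mem_union_right _ (Finset.mem_image.2 ⟨y, Finset.mem_univ _, rfl⟩)
  by_cases hτ : τ ∈ Rset
  swap
  · haveI : IsEmpty {x // v x = τ} := ⟨fun x => hτ (x.2 ▸ hvR x.1)⟩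
    haveI : IsEmpty {y // w y = τ} := ⟨fun y => hτ (y.2 ▸ hwR y.1)⟩
    simp
  -- degenerate case: no coordinates at all
  rcases isEmpty_or_nonempty ι with hι | hι
  · have hsub : ∀ ρ ρ' : ι → ℕ, ρ = ρ' := fun _ _ => funext fun i => (hι.false i).elim
    have h0 := h 0
    simp only [Finsupp.prod_zero_index, Finset.sum_const, Finset.card_univ, smul_eq_mul,
      mul_one] at h0
    rw [Nat.card_congr (Equiv.subtypeUnivEquiv fun x => hsub (v x) τ),
      Nat.card_congr (Equiv.subtypeUnivEquiv fun y => hsub (w y) τ), Nat.card_eq_fintype_card,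
      Nat.card_eq_fintype_card, h0]
  -- separating coordinates
  have hsep : ∀ ρ ∈ Rset, ∀ ρ' ∈ Rset, ρ ≠ ρ' → ∃ i, ρ i ≠ ρ' i :=
    fun _ _ _ _ hne => Function.ne_iff.1 hne
  choose! crd hcrd using hsep
  set I₀ : Finset ι := (Rset ×ˢ Rset).image (fun pr => crd pr.1 pr.2) with hI₀
  have hI : ∀ ρ ∈ Rset, ρ ≠ τ → ∃ i ∈ I₀, ρ i ≠ τ i := fun ρ hρ hne =>
    ⟨crd ρ τ, Finset.mem_image.2 ⟨(ρ, τ), Finset.mem_product.2 ⟨hρ, hτ⟩, rfl⟩, hcrd ρ hρ τ hτ hne⟩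
  set Vals : ι → Finset ℕ := fun i => Rset.image (fun ρ => ρ i) with hVals
  -- the interpolating polynomial
  set P : MvPolynomial ι ℚ :=
    ∏ i ∈ I₀, ∏ c ∈ (Vals i).erase (τ i),
      (C ((τ i : ℚ) - c)⁻¹ * (MvPolynomial.X i - C (c : ℚ))) with hP
  have heval : ∀ ρ ∈ Rset, eval (fun i => (ρ i : ℚ)) P = if ρ = τ then 1 else 0 := by
    intro ρ hρ
    simp only [hP, map_prod, map_mul, eval_C, map_sub, eval_X]
    split_ifs with hρτ
    · subst hρτ
      refine Finset.prod_eq_one fun i _ => Finset.prod_eq_one fun c hc => ?_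
      have hc' : (ρ i : ℚ) - c ≠ 0 := by
        rw [sub_ne_zero]; exact_mod_cast (Finset.ne_of_mem_erase hc).symm
      exact inv_mul_cancel₀ hc'
    · obtain ⟨i, hi, hne⟩ := hI ρ hρ hρτ
      refine Finset.prod_eq_zero hi (Finset.prod_eq_zero (i := ρ i) ?_ (by simp))
      exact Finset.mem_erase.2 ⟨hne, Finset.mem_image.2 ⟨ρ, hρ, rfl⟩⟩
  -- the linear functional `ρ ↦ eval ρ P` is a combination of moments
  have hlin : ∑ x, eval (fun i => (v x i : ℚ)) P = ∑ y, eval (fun i => (w y i : ℚ)) P := by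
    simp only [eval_eq]
    rw [Finset.sum_comm, Finset.sum_comm (s := (Finset.univ : Finset Y))]
    refine Finset.sum_congr rfl fun d _ => ?_
    rw [← Finset.mul_sum, ← Finset.mul_sum]
    congr 1
    have := congrArg (Nat.cast : ℕ → ℚ) (h d)
    simpa [Finsupp.prod] using this
  have hcv : ∑ x, eval (fun i => (v x i : ℚ)) P = Nat.card {x // v x = τ} := by
    rw [Finset.sum_congr rfl fun x _ => heval (v x) (hvR x), Finset.sum_boole,
      Nat.card_eq_fintype_card, Fintype.card_subtype]
  have hcw : ∑ y, eval (fun i => (w y i : ℚ)) P = Nat.card {y // w y = τ} := by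
    rw [Finset.sum_congr rfl fun y _ => heval (w y) (hwR y), Finset.sum_boole,
      Nat.card_eq_fintype_card, Fintype.card_subtype]
  have key := hlin
  rw [hcv, hcw] at key
  exact_mod_cast key

end Moments

/-! ### I. A bijection matching types and extending a partial bijection -/

section Bijection

/-- **Type-matching bijection extending a partial one.** Given injective enumerations `av`, `bv`
of two `ℓ`-sets and "type" maps `TG`, `TH` such that, off the enumerated sets, every type has
equally many realisations on both sides, there is a bijection `f : α ≃ β` with `f (av i) = bv i`
that preserves types off the enumerated set. [folklore] -/
theorem exists_equiv_extend {α β Φ : Type*} [Finite α] [Finite β] {ℓ : ℕ} (av : Fin ℓ → α)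
    (bv : Fin ℓ → β) (hav : Function.Injective av) (hbv : Function.Injective bv) (TG : α → Φ)
    (TH : β → Φ)
    (hfib : ∀ τ, Nat.card {a : {a // a ∉ Set.range av} // TG a.1 = τ} =
      Nat.card {b : {b // b ∉ Set.range bv} // TH b.1 = τ}) :
    ∃ f : α ≃ β, (∀ i, f (av i) = bv i) ∧
      ∀ a, a ∉ Set.range av → f a ∉ Set.range bv ∧ TH (f a) = TG a := by
  classical
  have ec : ∀ τ, {a : {a // a ∉ Set.range av} // TG a.1 = τ} ≃
      {b : {b // b ∉ Set.range bv} // TH b.1 = τ} :=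
    fun τ => Classical.choice (Finite.card_eq.1 (hfib τ))
  let e_c : {a // a ∉ Set.range av} ≃ {b // b ∉ Set.range bv} :=
    Equiv.ofFiberEquiv (f := fun a : {a // a ∉ Set.range av} => TG a.1)
      (g := fun b : {b // b ∉ Set.range bv} => TH b.1) ec
  have he_c : ∀ a, TH (e_c a).1 = TG a.1 := fun a =>
    Equiv.ofFiberEquiv_map (f := fun a : {a // a ∉ Set.range av} => TG a.1)
      (g := fun b : {b // b ∉ Set.range bv} => TH b.1) ec a
  let e_p : {a // a ∈ Set.range av} ≃ {b // b ∈ Set.range bv} :=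
    (Equiv.ofInjective av hav).symm.trans (Equiv.ofInjective bv hbv)
  have he_p : ∀ i, e_p ⟨av i, i, rfl⟩ = ⟨bv i, i, rfl⟩ := fun i => by
    simp only [e_p, Equiv.trans_apply]
    have : (Equiv.ofInjective av hav).symm ⟨av i, i, rfl⟩ = i := by
      rw [Equiv.symm_apply_eq]; rfl
    rw [this]; rfl
  let f : α ≃ β := (Equiv.sumCompl (· ∈ Set.range av)).symm.trans
    ((Equiv.sumCongr e_p e_c).trans (Equiv.sumCompl (· ∈ Set.range bv)))
  refine ⟨f, fun i => ?_, fun a ha => ?_⟩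
  · simp only [f, Equiv.trans_apply]
    rw [Equiv.sumCompl_symm_apply_of_pos (p := (· ∈ Set.range av)) ⟨i, rfl⟩]
    simp [he_p]
  · simp only [f, Equiv.trans_apply]
    rw [Equiv.sumCompl_symm_apply_of_neg (p := (· ∈ Set.range av)) ha]
    simp only [Equiv.sumCongr_apply, Sum.map_inr, Equiv.sumCompl_apply_inr]
    exact ⟨(e_c ⟨a, ha⟩).2, he_c ⟨a, ha⟩⟩

end Bijection

/-! ### J. Duplicator's strategy from equal homomorphism counts -/

section Products

/-- Powers of a test. [cite: Dvorak2010, §0 (Gᵏ, product of k copies)] -/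
theorem exists_lcount_eq_pow {k ℓ : ℕ} (hℓ : ℓ ≤ k) (t : Test k ℓ) (n : ℕ) :
    ∃ (r : ℕ) (P : SimpleGraph (Fin ℓ ⊕ Fin r)), LValid k ℓ P ∧
      ∀ (γ : Type) (G : SimpleGraph γ) (v : Fin ℓ → γ), lcount P G v = lcount t.2.1 G v ^ n := by
  obtain ⟨r, P, hP, h⟩ := exists_lcount_eq_prod hℓ (List.replicate n t)
  exact ⟨r, P, hP, fun γ G v => by rw [h, List.map_replicate, List.prod_replicate]⟩

/-- Monomials in tests are tests. [cite: Dvorak2010, §2 (closure under products)] -/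
theorem exists_lcount_eq_finsetProd {k ℓ : ℕ} (hℓ : ℓ ≤ k) (s : Finset (Test k ℓ))
    (e : Test k ℓ → ℕ) :
    ∃ (r : ℕ) (P : SimpleGraph (Fin ℓ ⊕ Fin r)), LValid k ℓ P ∧
      ∀ (γ : Type) (G : SimpleGraph γ) (v : Fin ℓ → γ),
        lcount P G v = ∏ t ∈ s, lcount t.2.1 G v ^ e t := by
  classical
  induction s using Finset.induction_on with
  | empty => exact ⟨0, ⊥, LValid.of_fin_zero ⊥ hℓ, fun γ G v => by simp [lcount_bot_fin_zero]⟩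
  | @insert t s hts ih =>
    obtain ⟨r₁, P₁, hP₁, h₁⟩ := exists_lcount_eq_pow hℓ t (e t)
    obtain ⟨r₂, P₂, hP₂, h₂⟩ := ih
    let e' : Fin ℓ ⊕ (Fin r₁ ⊕ Fin r₂) ≃ Fin ℓ ⊕ Fin (r₁ + r₂) :=
      Equiv.sumCongr (Equiv.refl (Fin ℓ)) finSumFinEquiv
    refine ⟨r₁ + r₂, (glue P₁ P₂).map e', (lvalid_glue hP₁ hP₂).map_equiv e' (fun i => rfl),
      fun γ G v => ?_⟩
    rw [lcount_map_equiv _ e' (fun i => rfl), lcount_glue, h₁, h₂, Finset.prod_insert hts]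

/-- Monomials in tests, `Finsupp` form. [cite: Dvorak2010, §2 (closure under products)] -/
theorem exists_lcount_eq_finsuppProd {k ℓ : ℕ} (hℓ : ℓ ≤ k) (m : Test k ℓ →₀ ℕ) :
    ∃ (r : ℕ) (P : SimpleGraph (Fin ℓ ⊕ Fin r)), LValid k ℓ P ∧
      ∀ (γ : Type) (G : SimpleGraph γ) (v : Fin ℓ → γ),
        lcount P G v = m.prod (fun t n => lcount t.2.1 G v ^ n) :=
  exists_lcount_eq_finsetProd hℓ m.support m

end Products

section Strategy

variable {α β : Type} [Fintype α] [Fintype β]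

/-- Pushing forward along an equivalence of vertex types does not change `|F →g G|`.
[folklore] -/
theorem card_hom_map_equiv {V W γ : Type*} (F : SimpleGraph V) (e : V ≃ W) (G : SimpleGraph γ) :
    Nat.card (F.map e →g G) = Nat.card (F →g G) :=
  Nat.card_congr
    { toFun := fun f => f.comp (Iso.map e F).toHom
      invFun := fun f => f.comp (Iso.map e F).symm.toHom
      left_inv := fun f => by ext x; simp
      right_inv := fun f => by ext x; simp }

/-- **The family of positions of the hom-count strategy**: finite positions `p` with at most `k`
pairs, partial injections, such that every valid `ℓ`-labelled test has the same labelled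
homomorphism counts into `(G, p-left)` and `(H, p-right)` under every assignment of its labels to
pairs of `p`. (The analogue, for the game, of the types used in Dvořák's Lemma 5.)
[cite: Dvorak2010, Lemma 5 and Thm 6 (1) ⇒ (2)] -/
def homFamily (k : ℕ) (G : SimpleGraph α) (H : SimpleGraph β) : Set (Set (α × β)) :=
  {p | p.Finite ∧ p.ncard ≤ k ∧ (∀ x ∈ p, ∀ y ∈ p, x.1 = y.1 ↔ x.2 = y.2) ∧
    ∀ (ℓ r : ℕ) (F : SimpleGraph (Fin ℓ ⊕ Fin r)), LValid k ℓ F → ∀ u : Fin ℓ → α × β,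
      (∀ i, u i ∈ p) → lcount F G (fun i => (u i).1) = lcount F H (fun i => (u i).2)}

omit [Fintype α] [Fintype β] in
/-- Level `0`: a valid unlabelled test is a graph of treewidth `< k`, so the hypothesis of the
bridge applies to it. [cite: Dvorak2010, Thm 6] -/
theorem lcount_eq_of_homCount {k : ℕ} (hk : 1 ≤ k) {G : SimpleGraph α} {H : SimpleGraph β}
    (hhom : ∀ (j : ℕ) (F : SimpleGraph (Fin j)), treewidth F < k →
      Nat.card (F →g G) = Nat.card (F →g H))
    {r : ℕ} (F : SimpleGraph (Fin 0 ⊕ Fin r)) (hF : LValid k 0 F) (u₁ : Fin 0 → α)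
    (u₂ : Fin 0 → β) : lcount F G u₁ = lcount F H u₂ := by
  obtain ⟨n, D, t₀, hD, -⟩ := hF
  let e : Fin 0 ⊕ Fin r ≃ Fin r := Equiv.emptySum _ _
  have htw : treewidth (F.map e) < k := by
    have := treewidth_map_le_of_card_bag_le D (w := k - 1) (fun t => by have := hD t; omega) e
    omega
  have key := hhom r (F.map e) htw
  rw [card_hom_map_equiv, card_hom_map_equiv, card_hom_eq_card_subtype,
    card_hom_eq_card_subtype] at key
  have h1 : lcount F G u₁ = Nat.card {g // IsHom F G g} :=
    Nat.card_congr (Equiv.subtypeEquivRight fun g => by simp)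
  have h2 : lcount F H u₂ = Nat.card {g // IsHom F H g} :=
    Nat.card_congr (Equiv.subtypeEquivRight fun g => by simp)
  rw [h1, h2]
  exact key

/-- **The forth property of the hom-count strategy** (heart of the direction hom counts ⇒ game):
types `T_G(a) = (t ↦ lcount t G (ā, a))` over valid `(ℓ+1)`-labelled tests have equal mixed
moments on both sides (glued products, then unlabelling, then `p ∈ homFamily`), hence equal
value distributions (interpolation), hence a type-preserving bijection extending `p`; every
new position then passes every test by pushing the test's labels into `Fin (ℓ+1)`.
[cite: Dvorak2010, Lemma 5 and Observation 4 (game form)] -/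
theorem homFamily_forth {k : ℕ} {G : SimpleGraph α} {H : SimpleGraph β} {p : Set (α × β)}
    (hp : p ∈ homFamily k G H) (hpk : p.ncard < k) :
    ∃ f : α ≃ β, ∀ a, insert (a, f a) p ∈ homFamily k G H := by
  classical
  obtain ⟨hfin, -, hinj, htest⟩ := hp
  -- enumerate `p`
  set ℓ := p.ncard with hℓ
  have hℓk : ℓ + 1 ≤ k := hpk
  have hcardfs : hfin.toFinset.card = ℓ := (Set.ncard_eq_toFinset_card p hfin).symm
  let ε : Fin ℓ ≃ {x // x ∈ hfin.toFinset} := (hfin.toFinset.equivFin.trans (finCongr hcardfs)).symm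
  have hεp : ∀ i, (ε i).1 ∈ p := fun i => hfin.mem_toFinset.1 (ε i).2
  have hpε : ∀ x ∈ p, ∃ i, (ε i).1 = x := fun x hx =>
    ⟨ε.symm ⟨x, hfin.mem_toFinset.2 hx⟩, by simp⟩
  obtain ⟨av, hav⟩ : ∃ av : Fin ℓ → α, ∀ i, av i = (ε i).1.1 := ⟨_, fun _ => rfl⟩
  obtain ⟨bv, hbv⟩ : ∃ bv : Fin ℓ → β, ∀ i, bv i = (ε i).1.2 := ⟨_, fun _ => rfl⟩
  have hav_inj : Function.Injective av := by
    intro i j hij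
    rw [hav, hav] at hij
    have h2 : (ε i).1.2 = (ε j).1.2 := (hinj _ (hεp i) _ (hεp j)).1 hij
    exact ε.injective (Subtype.ext (Prod.ext hij h2))
  have hbv_inj : Function.Injective bv := by
    intro i j hij
    rw [hbv, hbv] at hij
    have h1 : (ε i).1.1 = (ε j).1.1 := (hinj _ (hεp i) _ (hεp j)).2 hij
    exact ε.injective (Subtype.ext (Prod.ext h1 hij))
  have hεeq : ∀ i, (ε i).1 = (av i, bv i) := fun i => by rw [hav, hbv]
  -- the types
  obtain ⟨TG, hTG⟩ : ∃ TG : α → Test k (ℓ + 1) → ℕ,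
      ∀ a t, TG a t = lcount t.2.1 G (Fin.snoc av a : Fin (ℓ + 1) → α) := ⟨_, fun _ _ => rfl⟩
  obtain ⟨TH, hTH⟩ : ∃ TH : β → Test k (ℓ + 1) → ℕ,
      ∀ b t, TH b t = lcount t.2.1 H (Fin.snoc bv b : Fin (ℓ + 1) → β) := ⟨_, fun _ _ => rfl⟩
  -- C0: the enumerated pairs have equal types
  have hC0 : ∀ i, TG (av i) = TH (bv i) := by
    intro i
    funext t
    obtain ⟨r, F', hF'⟩ := t
    rw [hTG, hTH]
    obtain ⟨σ, hσc, hσl⟩ : ∃ σ : Fin (ℓ + 1) → Fin ℓ, (∀ j : Fin ℓ, σ j.castSucc = j) ∧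
        σ (Fin.last ℓ) = i := ⟨Fin.snoc (fun j => j) i, fun j => by simp, by simp⟩
    have hA : (Fin.snoc av (av i) : Fin (ℓ + 1) → α) = av ∘ σ := by
      funext j; induction j using Fin.lastCases with
      | last => simp [hσl]
      | cast j => simp [hσc]
    have hB : (Fin.snoc bv (bv i) : Fin (ℓ + 1) → β) = bv ∘ σ := by
      funext j; induction j using Fin.lastCases with
      | last => simp [hσl]
      | cast j => simp [hσc]
    change lcount F' G (Fin.snoc av (av i) : Fin (ℓ + 1) → α) =
      lcount F' H (Fin.snoc bv (bv i) : Fin (ℓ + 1) → β)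
    rw [hA, hB]
    by_cases hcol : ∃ j j', F'.Adj (Sum.inl j) (Sum.inl j') ∧ σ j = σ j'
    · obtain ⟨j, j', hjj', hσj⟩ := hcol
      rw [lcount_eq_zero_of_collision σ F' G _ hjj' hσj,
        lcount_eq_zero_of_collision σ F' H _ hjj' hσj]
    · push Not at hcol
      rw [← lcount_push σ F' hcol, ← lcount_push σ F' hcol]
      have := htest ℓ r (push σ F') (lvalid_push hF' σ (by omega)) (fun j => (ε j).1) hεp
      simpa only [hεeq] using this
  -- equal mixed moments
  have hmom : ∀ m : Test k (ℓ + 1) →₀ ℕ,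
      ∑ a, m.prod (fun t n => TG a t ^ n) = ∑ b, m.prod (fun t n => TH b t ^ n) := by
    intro m
    obtain ⟨r, P, hP, hprod⟩ := exists_lcount_eq_finsuppProd hℓk m
    have eG : ∑ a, m.prod (fun t n => TG a t ^ n) = lcount (unlabel P) G av := by
      rw [lcount_unlabel]
      refine Finset.sum_congr rfl fun a _ => ?_
      rw [hprod α G]
      simp only [hTG]
    have eH : ∑ b, m.prod (fun t n => TH b t ^ n) = lcount (unlabel P) H bv := by
      rw [lcount_unlabel]
      refine Finset.sum_congr rfl fun b _ => ?_
      rw [hprod β H]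
      simp only [hTH]
    rw [eG, eH]
    let e' : Fin ℓ ⊕ (Fin 1 ⊕ Fin r) ≃ Fin ℓ ⊕ Fin (1 + r) :=
      Equiv.sumCongr (Equiv.refl _) finSumFinEquiv
    rw [← lcount_map_equiv _ e' (fun i => rfl) G, ← lcount_map_equiv _ e' (fun i => rfl) H]
    have := htest ℓ (1 + r) _ ((lvalid_unlabel hP).map_equiv e' fun i => rfl) (fun j => (ε j).1) hεp
    simpa only [hεeq] using this
  -- equal mixed moments off the enumerated sets
  have hmom' : ∀ m : Test k (ℓ + 1) →₀ ℕ,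
      ∑ a : {a // a ∉ Set.range av}, m.prod (fun t n => TG a.1 t ^ n) =
        ∑ b : {b // b ∉ Set.range bv}, m.prod (fun t n => TH b.1 t ^ n) := by
    intro m
    have splitG : ∀ M : α → ℕ, ∑ a, M a =
        ∑ a : {a // a ∈ Set.range av}, M a.1 + ∑ a : {a // a ∉ Set.range av}, M a.1 := by
      intro M
      rw [← Fintype.sum_equiv (Equiv.sumCompl (· ∈ Set.range av))
        (fun x => M (Equiv.sumCompl (· ∈ Set.range av) x)) M (fun x => rfl), Fintype.sum_sum_type]
      simp
    have splitH : ∀ M : β → ℕ, ∑ b, M b =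
        ∑ b : {b // b ∈ Set.range bv}, M b.1 + ∑ b : {b // b ∉ Set.range bv}, M b.1 := by
      intro M
      rw [← Fintype.sum_equiv (Equiv.sumCompl (· ∈ Set.range bv))
        (fun x => M (Equiv.sumCompl (· ∈ Set.range bv) x)) M (fun x => rfl), Fintype.sum_sum_type]
      simp
    have hin : ∑ a : {a // a ∈ Set.range av}, m.prod (fun t n => TG a.1 t ^ n) =
        ∑ b : {b // b ∈ Set.range bv}, m.prod (fun t n => TH b.1 t ^ n) := by
      rw [← Fintype.sum_equiv (Equiv.ofInjective av hav_inj)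
          (fun i => m.prod (fun t n => TG (av i) t ^ n)) _ (fun i => rfl),
        ← Fintype.sum_equiv (Equiv.ofInjective bv hbv_inj)
          (fun i => m.prod (fun t n => TH (bv i) t ^ n)) _ (fun i => rfl)]
      exact Finset.sum_congr rfl fun i _ => by rw [hC0 i]
    have key := hmom m
    rw [splitG (fun a => m.prod (fun t n => TG a t ^ n)),
      splitH (fun b => m.prod (fun t n => TH b t ^ n)), hin] at key
    exact add_left_cancel key
  -- the bijection
  have hfib := card_fiber_eq_of_moments (fun a : {a // a ∉ Set.range av} => TG a.1)
    (fun b : {b // b ∉ Set.range bv} => TH b.1) hmom'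
  obtain ⟨f, hf₁, hf₂⟩ := exists_equiv_extend av bv hav_inj hbv_inj TG TH hfib
  refine ⟨f, fun a => ?_⟩
  by_cases ha : a ∈ Set.range av
  · obtain ⟨i, rfl⟩ := ha
    rw [hf₁ i, ← hεeq i, Set.insert_eq_of_mem (hεp i)]
    exact ⟨hfin, hpk.le, hinj, htest⟩
  obtain ⟨hb, hT⟩ := hf₂ a ha
  have hnew : ∀ y ∈ p, (a = y.1 ↔ f a = y.2) := by
    intro y hy
    obtain ⟨j, hj⟩ := hpε y hy
    rw [← hj, hεeq j]
    constructor
    · intro h; exact (ha ⟨j, h.symm⟩).elim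
    · intro h; exact (hb ⟨j, h.symm⟩).elim
  refine ⟨hfin.insert _, (Set.ncard_insert_le _ _).trans hℓk, ?_, ?_⟩
  · intro x hx y hy
    rcases hx with rfl | hx <;> rcases hy with rfl | hy
    · simp
    · exact hnew y hy
    · exact ⟨fun h => ((hnew x hx).1 h.symm).symm, fun h => ((hnew x hx).2 h.symm).symm⟩
    · exact hinj x hx y hy
  · intro ℓ' r F' hF' u hu
    have hex : ∀ i, ∃ c : Fin (ℓ + 1), (u i).1 = (Fin.snoc av a : Fin (ℓ + 1) → α) c ∧
        (u i).2 = (Fin.snoc bv (f a) : Fin (ℓ + 1) → β) c := by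
      intro i
      rcases Set.mem_insert_iff.1 (hu i) with h | h
      · exact ⟨Fin.last ℓ, by simp [h]⟩
      · obtain ⟨j, hj⟩ := hpε _ h
        exact ⟨j.castSucc, by simp [← hj, hεeq]⟩
    choose σ hσ using hex
    have eA : (fun i => (u i).1) = (Fin.snoc av a : Fin (ℓ + 1) → α) ∘ σ := funext fun i => (hσ i).1
    have eB : (fun i => (u i).2) = (Fin.snoc bv (f a) : Fin (ℓ + 1) → β) ∘ σ :=
      funext fun i => (hσ i).2
    rw [eA, eB]
    by_cases hcol : ∃ i j, F'.Adj (Sum.inl i) (Sum.inl j) ∧ σ i = σ j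
    · obtain ⟨i, j, hij, hσij⟩ := hcol
      rw [lcount_eq_zero_of_collision σ F' G _ hij hσij, lcount_eq_zero_of_collision σ F' H _ hij hσij]
    · push Not at hcol
      rw [← lcount_push σ F' hcol, ← lcount_push σ F' hcol]
      have := congrFun hT ⟨r, push σ F', lvalid_push hF' σ hℓk⟩
      rw [hTG, hTH] at this
      exact this.symm

/-- **Duplicator's winning strategy from equal homomorphism counts** (`k ≥ 2`): the family
`homFamily k G H`. The empty position is winning by the hypothesis (level `0` tests are the
graphs of treewidth `< k`); positions are partial isomorphisms by the edge test (which needs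
`k ≥ 2`); the forth property is `homFamily_forth`. [cite: Dvorak2010, Thm 6 ((1) ⇒ (2), game form)] -/
noncomputable def homStrategy {k : ℕ} (hk : 2 ≤ k) (G : SimpleGraph α) (H : SimpleGraph β)
    (hhom : ∀ (j : ℕ) (F : SimpleGraph (Fin j)), treewidth F < k →
      Nat.card (F →g G) = Nat.card (F →g H)) :
    BijPebbleStrategy k G H where
  carrier := homFamily k G H
  empty_mem := by
    refine ⟨Set.finite_empty, by simp, fun x hx => (Set.notMem_empty x hx).elim, ?_⟩
    intro ℓ r F hF u hu
    cases ℓ with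
    | zero => exact lcount_eq_of_homCount (by omega) hhom F hF _ _
    | succ ℓ => exact (Set.notMem_empty _ (hu 0)).elim
  finite_of_mem := fun _ hp => hp.1
  ncard_le_of_mem := fun _ hp => hp.2.1
  isPartialIso_of_mem := by
    intro p hp
    refine ⟨fun x hx y hy => hp.2.2.1 x hx y hy, fun x hx y hy => ?_⟩
    classical
    have key := hp.2.2.2 2 0 edgeTest (LValid.of_fin_zero edgeTest hk) ![x, y]
      (fun i => by fin_cases i <;> simp [hx, hy])
    rw [lcount_edgeTest, lcount_edgeTest] at key
    simp only [Matrix.cons_val_zero, Matrix.cons_val_one] at key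
    by_cases hG : G.Adj x.1 y.1 <;> by_cases hH : H.Adj x.2 y.2 <;> simp_all
  mem_of_subset := by
    intro p hp q hqp
    exact ⟨hp.1.subset hqp, (Set.ncard_le_ncard hqp hp.1).trans hp.2.1,
      fun x hx y hy => hp.2.2.1 x (hqp hx) y (hqp hy),
      fun ℓ r F hF u hu => hp.2.2.2 ℓ r F hF u fun i => hqp (hu i)⟩
  forth := fun _ hp hpk => homFamily_forth hp hpk

/-- **Hom counts ⇒ game** (`k ≥ 2`): if `hom(F, G) = hom(F, H)` for all `F` on `Fin j` of
treewidth `< k`, then `G ≡_{C^k} H`. [cite: Dvorak2010, Thm 6] -/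
theorem ckEquiv_of_homCount {k : ℕ} (hk : 2 ≤ k) {G : SimpleGraph α} {H : SimpleGraph β}
    (hhom : ∀ (j : ℕ) (F : SimpleGraph (Fin j)), treewidth F < k →
      Nat.card (F →g G) = Nat.card (F →g H)) : CkEquiv k G H :=
  ⟨homStrategy hk G H hhom⟩

end Strategy

end Dvorak2010

/-! ### K. The named fact, discharged -/

/-- **Dvořák 2010, Thm 6 / Dell–Grohe–Rattan 2018, Thm 3 with Hella's theorem, PROVED**: for
`k ≥ 2` and finite graphs `G`, `H` on `Fin n`, `Fin m`, Duplicator wins the bijective `k`-pebble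
game on `G`, `H` iff `hom(F, G) = hom(F, H)` for every finite `F` of treewidth `< k`. This
discharges the named fact `Dvorak2010_ckEquiv_iff_homCount`. The proof is the game-theoretic
form of Dvořák's (labelled graphs of bounded tree-width, products and label removal, the
interpolation Observation 4), see the module docstring. [cite: Dvorak2010, Thm 6] -/
theorem Dvorak2010_ckEquiv_iff_homCount_holds : Dvorak2010_ckEquiv_iff_homCount := by
  intro k hk n m G H
  constructor
  · intro h j F hF
    exact Dvorak2010.homCount_eq_of_ckEquiv (by omega) h F hF
  · intro h
    exact Dvorak2010.ckEquiv_of_homCount hk h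







end Literature.ModelTheory.FiniteModelTheory
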